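import Literature.NumberTheory.LFunctions.RiemannMethodGRHVerification
import Literature.NumberTheory.LFunctions.DirichletXiPairMultiplicity
import Literature.NumberTheory.LFunctions.DirichletLZeroCounting
import Literature.NumberTheory.LFunctions.ZetaLogDerivSeries
import Literature.NumberTheory.LFunctions.PrimitiveQuadraticCharacterGaussSum
import Literature.NumberTheory.LFunctions.DedekindZetaCentralOrderEven
import Literature.NumberTheory.LFunctions.NoRealZeroUpTo
import Literature.NumberTheory.LFunctions.DirichletLRiemannHypothesisUpTo
import HarnessLib

/-!
# Hiary–Ireland–Kyi, «A method for verifying the generalized Riemann hypothesis» (Math. Comp. 2026),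
# Theorem 7 and Corollary 1 for primitive quadratic `χ` — PROVED
# (`hiaryIrelandKyi2026_theorem7_holds`, `hiaryIrelandKyi2026_corollary1_holds`)

Topic `Literature/NumberTheory/LFunctions`; proofs for the named facts of `RiemannMethodGRHVerification.lean`
(Hiary–Ireland–Kyi, Math. Comp. 2026 = arXiv:2408.00187, §4 Theorem 7 with Lemma 4 / Corollary 5, §3 Lemma 6, §1
Corollary 1).  Everything here is PROVED (theorems only; no definitions, no named facts; standard axioms).  RH-FREE and
GRH-FREE.

## Contents

* §3 Lemma 6 in the form used: `min_phi_le` (`min(φ(0,η,x), φ(½,η,x)) ≤ φ(β,η,x)` on `[0,1]`, `x ≤ 0`, `η > 0`),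
  `phi_half_zero_le`, `phi_le_phi_of_sq_le`, `phi_nonneg`;
* Lemma 4 / Corollary 5: `re_logDeriv_dirichletXi_eq_wOne` (`Re ξ'/ξ(1−δ, χ) = w_{1,δ}`), `two_mul_wOne_eq_tsum`
  (`2w_{1,δ} = Σₙ Re[1/(s₀−ρₙ) + 1/(s₀−(1−ρₙ))]` over the Hadamard pairs of `Ξ_χ = ξ(·,χ)²`), `re_term_nonneg`,
  `sum_re_term_le_two_mul_wOne`; multiplicities `card_index_eq_two_mul`, `card_index_half_eq`,
  `sum_zeroOrder_le_card_biUnion`;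
* Theorem 7, `m = 1`: `hiaryIrelandKyi2026_theorem7_holds` ((i), (iii), (iv) — the named fact), `zeros_complete` ((v), with
  (ii) at `m = 1`); general `m` (zeros counted with multiplicity): `sum_zeroOrder_offLine_lt` ((i): `< 4m`),
  `sum_zeroOrder_real_lt` ((iii): `< 2m`), `zeroOrder_half_lt` ((iv): `< m`);
* Corollary 1: `hiaryIrelandKyi2026_corollary1_holds` (the named fact, `d > 0`), `corollary1_any_parity` (either parity,
  so also `d < 0`), `even_zeroOrder_half` (`ord_{½} L(s, χ)` is even), `wOne_neg_one_of_odd`;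
* certificates and bridges: `LFunction_ne_zero_of_signChangeData` / `_of_wOne_lt` (no real zero in `(0,1)`),
  `NoRealZeroUpTo.of_riemannMethod` (the cell's wide criterion), `LFunctionRHUpTo.of_riemannMethod` (RH up to height `η`).

## The printed argument and its formalisation

Lemma 4 / Corollary 5 (p. 8 of arXiv:2408.00187): by the Hadamard product of `ξ_L`, for real `δ < 1` with `ξ_L(δ) ≠ 0`,
`w_{1,δ} := Σ_ρ 1/(ρ − δ)` (paired) `= ½ log N − (r/2) log π + ½ Σ_j ψ₀(½ − δ/2 + μ_j/2) + d_{1,δ}`, `d_{1,δ} = (L'/L)(1 − δ)`.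
Proof of Theorem 7 (p. 13): every pair `{ρ, 1 − ρ̄}` contributes `Re[1/(ρ−δ) + 1/(1−ρ̄−δ)] = φ(β, γ, δ) ≥ 0`
(`δ ≤ 0`); the known zeros of `𝒵` contribute at least `C(𝒵, δ)`; a counter-example and its three symmetric images
contribute at least `f₁(η, δ, 1) = 2 min(φ(0,η,δ), φ(½,η,δ))` (Lemma 6 and the monotonicity of `φ` in `η`), a real
pair `{β, 1−β}` at least `h₁ = φ(½, 0, δ)`, a central zero at least `h₂ = ½ φ(½, 0, δ)`, an unaccounted critical zero at
least `φ(½, η, δ)`; contradiction.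

Formalisation (for `L = L(·, χ)`, `χ` primitive quadratic, so `χ̄ = χ`, `ε = 1`, `r = 1`, `N = q`, `μ₁ = κ`):
* the tree's Hadamard product in genus zero of the pair `Ξ_χ = ξ(·,χ)ξ(·,χ̄) = ξ(·,χ)²`
  (`DirichletTheta.exists_xiPair_hadamardSeq`) and its partial-fraction series
  (`logDeriv_xiPair_half_add_eq_tsum`, terms `1/(s−ρₙ) + 1/(s−(1−ρₙ))`) give, at `s₀ = 1 − δ ≥ 1`,
  `2·Re(ξ'/ξ)(s₀, χ) = Σₙ Re[1/(s₀−ρₙ) + 1/(s₀−(1−ρₙ))]` with NON-NEGATIVE terms (`re_term_nonneg`);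
* `Re(ξ'/ξ)(1 − δ, χ) = w_{1,δ}` in the closed form `HiaryIrelandKyi2026.wOne` (`logDeriv_dirichletXi_eq`,
  `logDeriv_Gammaℝ`: `Γ_ℝ'/Γ_ℝ(w) = −½ log π + ½ ψ₀(w/2)`) — this is Lemma 4 / Corollary 5 (`two_mul_wOne_eq_tsum`);
* multiplicities: the indices `n` with `ρₙ ∈ {ρ, 1 − ρ}` number `m_χ(ρ) + m_χ̄(ρ) = 2 m_χ(ρ)` (`ncard_index_add_ncard_index_eq`),
  so every zero `ρ ≠ ½` of `L(s, χ)` owns at least two terms of value `φ(Re ρ, Im ρ, δ)`, the centre at least one; an index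
  belongs to the blocks of at most two points (double counting, `sum_zeroOrder_le_card_biUnion`);
* Lemma 6 in the form used: `min(φ(0,η,x), φ(½,η,x)) ≤ φ(β,η,x)` for `β ∈ [0,1]`, `x ≤ 0`, `η > 0` (`min_phi_le`), from
  `∂φ/∂β = −(2β−1)(2x−1)G/[…]²` with the printed quartic `G` (identity checked by `ring`), `G` non-decreasing on `[0, ½]`
  by the finite-difference factorisation of `∂G/∂β = 2(2β−1)(β²−β−η²+x−x²)`;
* sign change ⇒ critical-line zero (`exists_zero_of_signChange`: `ξ(½+it,χ)` is real, IVT); odd-multiplicity zero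
  ⇒ `t > 0` (`even_zeroOrder_half`, the tree's `CentralOrder.even_analyticOrderNatAt_of_eventually`);
* (v): if the interval `P₀ ∋ Im ρ` carried a second critical zero, or `ρ` were multiple, the data `𝒵 ∖ {P₀}` plus the
  block(s) over `P₀` already exceed `2w_{1,δ}` (`zeros_complete`).
[cite: HiaryIrelandKyi2026, §4 Theorem 7, Lemma 4, Corollary 5; §3 Lemma 6; §8 (proof of Lemma 6); §1 Corollary 1]
-/

noncomputable section

open Complex Filter Topology Set Finset
open scoped ComplexConjugate

namespace Literature.NumberTheory.LFunctions

namespace HiaryIrelandKyi2026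

/-! ### §3 Lemma 6 (the part used): `min(φ(0,η,x), φ(½,η,x)) ≤ φ(β,η,x)` on `β ∈ [0,1]` -/

section PhiLemma

/-- `φ(1 − β, η, x) = φ(β, η, x)`. [cite: HiaryIrelandKyi2026, §3 (definition of φ)] -/
theorem phi_one_sub (β η x : ℝ) : phi (1 - β) η x = phi β η x := by
  simp only [phi]
  ring_nf

/-- `φ(β, −η, x) = φ(β, η, x)`. [cite: HiaryIrelandKyi2026, §3 (definition of φ)] -/
theorem phi_neg_eta (β η x : ℝ) : phi β (-η) x = phi β η x := by
  simp only [phi, neg_sq]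

/-- `φ(β, η, x) ≥ 0` for `0 ≤ β ≤ 1`, `x ≤ 0`. [cite: HiaryIrelandKyi2026, §3 Lemma 6] -/
theorem phi_nonneg {β η x : ℝ} (hβ0 : 0 ≤ β) (hβ1 : β ≤ 1) (hx : x ≤ 0) : 0 ≤ phi β η x := by
  simp only [phi]
  have h1 : 0 ≤ β - x := by linarith
  have h2 : 0 ≤ 1 - β - x := by linarith
  positivity

/-- `φ` is non-increasing in `η²`: for `γ² ≤ η²`, `φ(β, η, x) ≤ φ(β, γ, x)` (`0 ≤ β ≤ 1`, `x ≤ 0`, `γ ≠ 0`).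
[cite: HiaryIrelandKyi2026, §3 Lemma 6 (iv)] -/
theorem phi_le_phi_of_sq_le {β γ η x : ℝ} (hβ0 : 0 ≤ β) (hβ1 : β ≤ 1) (hx : x ≤ 0) (hγ : γ ≠ 0)
    (h : γ ^ 2 ≤ η ^ 2) : phi β η x ≤ phi β γ x := by
  simp only [phi]
  have h1 : 0 ≤ β - x := by linarith
  have h2 : 0 ≤ 1 - β - x := by linarith
  have hγ2 : 0 < γ ^ 2 := by positivity
  gcongr

/-- `φ(½, 0, x) ≤ φ(β, 0, x)` for `0 < β < 1`, `x ≤ 0` (`1/u + 1/v ≥ 4/(u + v)`).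
[cite: HiaryIrelandKyi2026, §3 Lemma 6 (i) (η = 0)] -/
theorem phi_half_zero_le {β x : ℝ} (hβ0 : 0 < β) (hβ1 : β < 1) (hx : x ≤ 0) : phi (1 / 2) 0 x ≤ phi β 0 x := by
  simp only [phi]
  have h1 : 0 < β - x := by linarith
  have h2 : 0 < 1 - β - x := by linarith
  have h3 : 0 < 1 / 2 - x := by linarith
  rw [show (1 : ℝ) - 1 / 2 - x = 1 / 2 - x by ring]
  simp only [ne_eq, OfNat.ofNat_ne_zero, not_false_eq_true, zero_pow, add_zero]
  rw [show (β - x) / (β - x) ^ 2 = 1 / (β - x) by field_simp,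
    show (1 - β - x) / (1 - β - x) ^ 2 = 1 / (1 - β - x) by field_simp,
    show (1 / 2 - x) / (1 / 2 - x) ^ 2 = 1 / (1 / 2 - x) by field_simp]
  rw [div_add_div _ _ h3.ne' h3.ne', div_add_div _ _ h1.ne' h2.ne', div_le_div_iff₀ (by positivity) (by positivity)]
  nlinarith [sq_nonneg (β - 1 / 2), h1, h2, h3, mul_pos h1 h2]

/-- `φ(½, 0, x) = 2/(½ − x)`. [cite: HiaryIrelandKyi2026, §4 Theorem 7 (h₁)] -/
theorem phi_half_zero {x : ℝ} (hx : x < 1 / 2) : phi (1 / 2) 0 x = 2 / (1 / 2 - x) := by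
  simp only [phi]
  have h3 : (1 / 2 : ℝ) - x ≠ 0 := by intro h; linarith
  rw [show (1 : ℝ) - 1 / 2 - x = 1 / 2 - x by ring, zero_pow two_ne_zero, add_zero,
    show (1 / 2 - x) / (1 / 2 - x) ^ 2 = 1 / (1 / 2 - x) by field_simp]
  ring

/-- `φ(½, t, x) = (1 − 2x)/((½ − x)² + t²)` — the contribution of a pair of critical-line zeros `½ ± it`.
[cite: HiaryIrelandKyi2026, §4 Theorem 7 (definition of C(𝒵, δ))] -/
theorem phi_half (t x : ℝ) : phi (1 / 2) t x = (1 - 2 * x) / ((1 / 2 - x) ^ 2 + t ^ 2) := by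
  simp only [phi]
  rw [show (1 : ℝ) - 1 / 2 - x = 1 / 2 - x by ring]
  ring

/-- A finite-difference form of `∂G/∂β = 2(2β−1)(β²−β−η²+x−x²)`: with `s = t₁ + t₂`, `p = t₁t₂`,
`G(t₂) − G(t₁) = (t₂ − t₁)(s(s−1)² + 2(η² − x + x²)(1 − s) + 2p(1 − s))`. [cite: HiaryIrelandKyi2026, §8 (deriv_beta)] -/
private theorem quarticG_sub (η x t₁ t₂ : ℝ) :
    (t₂ ^ 4 - 2 * t₂ ^ 3 + (1 - 2 * η ^ 2 + 2 * x - 2 * x ^ 2) * t₂ ^ 2 + 2 * (η ^ 2 - x + x ^ 2) * t₂ +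
        η ^ 2 * (2 * x - 2 * x ^ 2 - 1 - 3 * η ^ 2) + x ^ 2 * (1 - 2 * x + x ^ 2)) -
      (t₁ ^ 4 - 2 * t₁ ^ 3 + (1 - 2 * η ^ 2 + 2 * x - 2 * x ^ 2) * t₁ ^ 2 + 2 * (η ^ 2 - x + x ^ 2) * t₁ +
        η ^ 2 * (2 * x - 2 * x ^ 2 - 1 - 3 * η ^ 2) + x ^ 2 * (1 - 2 * x + x ^ 2)) =
      (t₂ - t₁) * ((t₁ + t₂) * (t₁ + t₂ - 1) ^ 2 + 2 * (η ^ 2 - x + x ^ 2) * (1 - (t₁ + t₂)) +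
        2 * (t₁ * t₂) * (1 - (t₁ + t₂))) := by
  ring

/-- `G(·, η, x)` is non-decreasing on `[0, ½]` (`x ≤ 0`). [cite: HiaryIrelandKyi2026, §8 (proof of Lemma 6)] -/
private theorem monotoneOn_quarticG {η x : ℝ} (hx : x ≤ 0) :
    MonotoneOn (fun β : ℝ => (β ^ 4 - 2 * β ^ 3 + (1 - 2 * η ^ 2 + 2 * x - 2 * x ^ 2) * β ^ 2 + 2 * (η ^ 2 - x + x ^ 2) * β +
        η ^ 2 * (2 * x - 2 * x ^ 2 - 1 - 3 * η ^ 2) + x ^ 2 * (1 - 2 * x + x ^ 2))) (Icc 0 (1 / 2)) := by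
  intro t₁ ht₁ t₂ ht₂ h12
  dsimp only
  rw [← sub_nonneg, quarticG_sub]
  have h1 : 0 ≤ t₂ - t₁ := by linarith
  have hs0 : 0 ≤ t₁ + t₂ := by linarith [ht₁.1, ht₂.1]
  have hs1 : 0 ≤ 1 - (t₁ + t₂) := by linarith [ht₁.2, ht₂.2]
  have hp : 0 ≤ t₁ * t₂ := mul_nonneg ht₁.1 ht₂.1
  have hq : 0 ≤ η ^ 2 - x + x ^ 2 := by nlinarith [sq_nonneg η, sq_nonneg x]
  apply mul_nonneg h1
  have := sq_nonneg (t₁ + t₂ - 1)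
  positivity

/-- The `β`-derivative of `φ`: `∂φ/∂β = −(2β−1)(2x−1)G/(D₁²D₂²)`, `D₁ = (β−x)²+η²`, `D₂ = (1−β−x)²+η²` — the paper's
computer-algebra identity (phi beta), here checked by `ring`. [cite: HiaryIrelandKyi2026, §8 (phi beta)] -/
private theorem hasDerivAt_phi {η x : ℝ} (hη : 0 < η) (β : ℝ) :
    HasDerivAt (fun b => phi b η x)
      (-((2 * β - 1) * (2 * x - 1) *
        (β ^ 4 - 2 * β ^ 3 + (1 - 2 * η ^ 2 + 2 * x - 2 * x ^ 2) * β ^ 2 + 2 * (η ^ 2 - x + x ^ 2) * β +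
        η ^ 2 * (2 * x - 2 * x ^ 2 - 1 - 3 * η ^ 2) + x ^ 2 * (1 - 2 * x + x ^ 2))) /
        (((β - x) ^ 2 + η ^ 2) ^ 2 * ((1 - β - x) ^ 2 + η ^ 2) ^ 2)) β := by
  have hD1 : (β - x) ^ 2 + η ^ 2 ≠ 0 := by positivity
  have hn1 : HasDerivAt (fun b : ℝ => b - x) 1 β := (hasDerivAt_id' β).sub_const x
  have hd1 : HasDerivAt (fun b : ℝ => (b - x) ^ 2 + η ^ 2) (((2 : ℕ) : ℝ) * (β - x) ^ (2 - 1) * 1) β :=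
    (hn1.fun_pow 2).add_const (η ^ 2)
  have h1 := hn1.fun_div hd1 hD1
  have hD2 : (1 - β - x) ^ 2 + η ^ 2 ≠ 0 := by positivity
  have hn2 : HasDerivAt (fun b : ℝ => 1 - b - x) (-1) β := ((hasDerivAt_id' β).const_sub 1).sub_const x
  have hd2 : HasDerivAt (fun b : ℝ => (1 - b - x) ^ 2 + η ^ 2) (((2 : ℕ) : ℝ) * (1 - β - x) ^ (2 - 1) * (-1)) β :=
    (hn2.fun_pow 2).add_const (η ^ 2)
  have h2 := hn2.fun_div hd2 hD2
  have h := h1.fun_add h2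
  refine h.congr_deriv ?_
  field_simp
  ring

/-- `φ(·, η, x)` is differentiable (`η > 0`). [cite: HiaryIrelandKyi2026, §8 (phi beta)] -/
private theorem differentiable_phi {η x : ℝ} (hη : 0 < η) : Differentiable ℝ fun b => phi b η x :=
  fun b => (hasDerivAt_phi hη b).differentiableAt

/-- **Lemma 6, the part used in Theorem 7:** for `0 ≤ β ≤ 1`, `x ≤ 0`, `η > 0`,
`min(φ(0, η, x), φ(½, η, x)) ≤ φ(β, η, x)` (the minimum of `φ(·, η, x)` over `[0, 1]` is attained at `β ∈ {0, ½, 1}`: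
on `[0, ½]` the sign of `∂φ/∂β` is that of `−G`, and `G` is non-decreasing there).
[cite: HiaryIrelandKyi2026, §3 Lemma 6 (i)–(ii); §8] -/
theorem min_phi_le {β η x : ℝ} (hβ0 : 0 ≤ β) (hβ1 : β ≤ 1) (hx : x ≤ 0) (hη : 0 < η) :
    min (phi 0 η x) (phi (1 / 2) η x) ≤ phi β η x := by
  -- reduce to `β ≤ ½`
  wlog hβ : β ≤ 1 / 2 generalizing β
  · have h := this (β := 1 - β) (by linarith) (by linarith) (by linarith)
    rwa [phi_one_sub] at h
  have hGmono := monotoneOn_quarticG (η := η) hx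
  have hβI : β ∈ Icc (0 : ℝ) (1 / 2) := ⟨hβ0, hβ⟩
  -- sign of the derivative in terms of `G`
  have hderiv_sign : ∀ b : ℝ, b < 1 / 2 →
      (0 ≤ (b ^ 4 - 2 * b ^ 3 + (1 - 2 * η ^ 2 + 2 * x - 2 * x ^ 2) * b ^ 2 + 2 * (η ^ 2 - x + x ^ 2) * b +
        η ^ 2 * (2 * x - 2 * x ^ 2 - 1 - 3 * η ^ 2) + x ^ 2 * (1 - 2 * x + x ^ 2)) → deriv (fun b => phi b η x) b ≤ 0) ∧
      ((b ^ 4 - 2 * b ^ 3 + (1 - 2 * η ^ 2 + 2 * x - 2 * x ^ 2) * b ^ 2 + 2 * (η ^ 2 - x + x ^ 2) * b +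
        η ^ 2 * (2 * x - 2 * x ^ 2 - 1 - 3 * η ^ 2) + x ^ 2 * (1 - 2 * x + x ^ 2)) ≤ 0 → 0 ≤ deriv (fun b => phi b η x) b) := by
    intro b hb
    rw [(hasDerivAt_phi (x := x) hη b).deriv]
    have hD : 0 < ((b - x) ^ 2 + η ^ 2) ^ 2 * ((1 - b - x) ^ 2 + η ^ 2) ^ 2 := by positivity
    have hc : 0 ≤ (2 * b - 1) * (2 * x - 1) := by nlinarith
    constructor
    · intro hG
      apply div_nonpos_of_nonpos_of_nonneg _ hD.le
      nlinarith
    · intro hG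
      apply div_nonneg _ hD.le
      nlinarith
  rcases le_total 0 (β ^ 4 - 2 * β ^ 3 + (1 - 2 * η ^ 2 + 2 * x - 2 * x ^ 2) * β ^ 2 + 2 * (η ^ 2 - x + x ^ 2) * β +
        η ^ 2 * (2 * x - 2 * x ^ 2 - 1 - 3 * η ^ 2) + x ^ 2 * (1 - 2 * x + x ^ 2)) with hG | hG
  · -- `G ≥ 0` on `[β, ½]`: `φ` non-increasing there, so `φ(½) ≤ φ(β)`
    have hanti : AntitoneOn (fun b => phi b η x) (Icc β (1 / 2)) := by
      refine antitoneOn_of_deriv_nonpos (convex_Icc _ _) ((differentiable_phi hη).continuous.continuousOn)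
        ((differentiable_phi hη).differentiableOn) fun b hb => ?_
      rw [interior_Icc] at hb
      have hGb : 0 ≤ (b ^ 4 - 2 * b ^ 3 + (1 - 2 * η ^ 2 + 2 * x - 2 * x ^ 2) * b ^ 2 + 2 * (η ^ 2 - x + x ^ 2) * b +
        η ^ 2 * (2 * x - 2 * x ^ 2 - 1 - 3 * η ^ 2) + x ^ 2 * (1 - 2 * x + x ^ 2)) :=
        hG.trans (hGmono hβI ⟨hβ0.trans hb.1.le, hb.2.le⟩ hb.1.le)
      exact (hderiv_sign b hb.2).1 hGb
    have h := hanti ⟨le_refl β, hβ⟩ ⟨hβ, le_refl _⟩ hβ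
    exact (min_le_right _ _).trans h
  · -- `G ≤ 0` on `[0, β]`: `φ` non-decreasing there, so `φ(0) ≤ φ(β)`
    have hmono : MonotoneOn (fun b => phi b η x) (Icc 0 β) := by
      refine monotoneOn_of_deriv_nonneg (convex_Icc _ _) ((differentiable_phi hη).continuous.continuousOn)
        ((differentiable_phi hη).differentiableOn) fun b hb => ?_
      rw [interior_Icc] at hb
      have hGb : (b ^ 4 - 2 * b ^ 3 + (1 - 2 * η ^ 2 + 2 * x - 2 * x ^ 2) * b ^ 2 + 2 * (η ^ 2 - x + x ^ 2) * b +
        η ^ 2 * (2 * x - 2 * x ^ 2 - 1 - 3 * η ^ 2) + x ^ 2 * (1 - 2 * x + x ^ 2)) ≤ 0 :=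
        (hGmono ⟨hb.1.le, hb.2.le.trans hβ⟩ hβI hb.2.le).trans hG
      exact (hderiv_sign b (by linarith [hb.2])).2 hGb
    have h := hmono ⟨le_refl 0, hβ0⟩ ⟨hβ0, le_refl β⟩ hβ0
    exact (min_le_left _ _).trans h

end PhiLemma

/-! ### Lemma 4 / Corollary 5 for `L(s, χ)`: `2·w_{1,δ} = Σₙ Re[1/(s₀ − ρₙ) + 1/(s₀ − (1 − ρₙ))]`, `s₀ = 1 − δ` -/

section ZeroSum

open DirichletTheta

variable {q : ℕ} [NeZero q] {χ : DirichletCharacter ℂ q}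

/-- For a quadratic character `Ξ_χ = ξ(·, χ)²` (`χ̄ = χ`). [cite: HiaryIrelandKyi2026, §4 (ξ_L for real coefficients)] -/
theorem xiPair_eq_sq (hquad : χ.IsQuadratic) (s : ℂ) : xiPair χ s = dirichletXi χ s ^ 2 := by
  rw [xiPair, hquad.inv, sq]

/-- `ξ(s₀, χ) ≠ 0` at the real point `s₀ = 1 − δ ≥ 1`. [cite: HiaryIrelandKyi2026, §4 Lemma 4 (hypothesis ξ_L(δ) ≠ 0)] -/
theorem dirichletXi_ne_zero_one_sub (hχ : χ.IsPrimitive) (h1 : χ ≠ 1) {δ : ℝ} (hδ : δ ≤ 0) :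
    dirichletXi χ (((1 - δ : ℝ)) : ℂ) ≠ 0 :=
  dirichletXi_ne_zero_of_not_mem_strip hχ h1 (Or.inr (by simp only [Complex.ofReal_re]; linarith))

/-- **Corollary 5 (`r = 1`, `N = q`, `μ₁ = κ`): `Re (ξ'/ξ)(1 − δ, χ) = w_{1,δ}`** in the closed form
`½ log q − ½ log π + ½ ψ₀((1 − δ + κ)/2) + (L'/L)(1 − δ, χ)` (`δ ≤ 0`, `χ ≠ 1`).
[cite: HiaryIrelandKyi2026, §4 Lemma 4, Corollary 5] -/
theorem re_logDeriv_dirichletXi_eq_wOne (h1 : χ ≠ 1) {δ : ℝ} (hδ : δ ≤ 0) :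
    (logDeriv (dirichletXi χ) (((1 - δ : ℝ)) : ℂ)).re = wOne χ δ := by
  set s₀ : ℂ := ((1 - δ : ℝ) : ℂ) with hs₀
  have hre : s₀.re = 1 - δ := by simp [hs₀]
  have hs : 0 < s₀.re := by rw [hre]; linarith
  have hL : χ.LFunction s₀ ≠ 0 :=
    DirichletCharacter.LFunction_ne_zero_of_one_le_re χ (Or.inl h1) (by rw [hre]; linarith)
  have hκ : ∀ m : ℕ, (s₀ + (charParity χ : ℂ)) / 2 ≠ -(m : ℂ) := by
    intro m h
    have h' := congrArg Complex.re h
    simp only [Complex.div_ofNat_re, Complex.add_re, hre, Complex.natCast_re, Complex.neg_re] at h'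
    have : (0 : ℝ) ≤ charParity χ := Nat.cast_nonneg _
    have : (0 : ℝ) ≤ m := Nat.cast_nonneg _
    linarith
  rw [logDeriv_apply, logDeriv_dirichletXi_eq h1 hs hL, Literature.NumberTheory.LFunctions.logDeriv_Gammaℝ hκ,
    ← Complex.ofReal_log Real.pi_pos.le,
    show (s₀ + (charParity χ : ℂ)) / 2 = ((((1 - δ + (charParity χ : ℝ)) / 2 : ℝ)) : ℂ) by
      rw [hs₀]; push_cast; ring,
    logDeriv_apply]
  simp only [wOne, Complex.add_re, Complex.neg_re, Complex.div_ofNat_re, Complex.ofReal_re, hs₀]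
  push_cast
  ring

variable {b : ℕ → ℂ}

/-- `(ρₙ − ½)² = 9/4 + 1/bₙ`. [folklore] -/
private theorem xiPairZero_sub_half_sq'' (b : ℕ → ℂ) (n : ℕ) :
    (xiPairZero b n - 1 / 2) ^ 2 = 9 / 4 + (b n)⁻¹ := by
  rw [xiPairZero, add_sub_cancel_left, Literature.Analysis.Complex.KiKim.cpow_half_sq]

/-- **The value of a pair term**: for `bₙ ≠ 0` with `ρₙ ∈ {ρ, 1 − ρ}` and real `s₀ = 1 − δ` off the pair,
`Re[1/(s₀−ρₙ) + 1/(s₀−(1−ρₙ))] = φ(Re ρ, Im ρ, δ)`. [cite: HiaryIrelandKyi2026, §4 (proof of Theorem 7: «contribute φ(β, γ, δ)»)] -/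
theorem re_term_eq_phi {n : ℕ} (hb : b n ≠ 0) {δ : ℝ}
    (hfac : 1 - b n * (((((1 - δ : ℝ)) : ℂ) - 1 / 2) ^ 2 - 9 / 4) ≠ 0) {ρ : ℂ}
    (hρ : xiPairZero b n = ρ ∨ 1 - xiPairZero b n = ρ) :
    (-(2 * b n * ((((1 - δ : ℝ)) : ℂ) - 1 / 2)) / (1 - b n * (((((1 - δ : ℝ)) : ℂ) - 1 / 2) ^ 2 - 9 / 4))).re =
      phi ρ.re ρ.im δ := by
  rw [DirichletTheta.term_eq_inv_add_inv b hb hfac]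
  have hρn : xiPairZero b n = ρ ∨ xiPairZero b n = 1 - ρ := by
    rcases hρ with h | h
    · exact Or.inl h
    · exact Or.inr (by rw [← h]; ring)
  have key : ∀ w : ℂ, (w = ρ ∨ w = 1 - ρ) →
      (((((1 - δ : ℝ)) : ℂ) - w)⁻¹ + ((((1 - δ : ℝ)) : ℂ) - (1 - w))⁻¹).re = phi ρ.re ρ.im δ := by
    intro w hw
    rcases hw with rfl | rfl
    · simp only [Complex.add_re, Complex.inv_re, Complex.normSq_apply, Complex.sub_re, Complex.sub_im,
        Complex.one_re, Complex.one_im, Complex.ofReal_re, Complex.ofReal_im, phi]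
      ring
    · simp only [Complex.add_re, Complex.inv_re, Complex.normSq_apply, Complex.sub_re, Complex.sub_im,
        Complex.one_re, Complex.one_im, Complex.ofReal_re, Complex.ofReal_im, phi]
      ring
  exact key _ hρn

/-- **Non-negativity of every term** at `s₀ = 1 − δ ≥ 1`: `Re[1/(s₀−ρₙ) + 1/(s₀−(1−ρₙ))] ≥ 0` (`0 < Re ρₙ < 1`), and the
term is `0` when `bₙ = 0`. [cite: HiaryIrelandKyi2026, §3 Lemma 6 («φ(β, η, x) ≥ 0»); §4 proof of Theorem 7] -/
theorem re_term_nonneg (hχ : χ.IsPrimitive) (h1 : χ ≠ 1) {δ : ℝ} (hδ : δ ≤ 0)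
    (hprod : ∀ z : ℂ, HasProd (fun n ↦ 1 - b n * (z ^ 2 - 9 / 4)) (xiPair χ (1 / 2 + z) / xiPair χ 2)) (n : ℕ) :
    0 ≤ (-(2 * b n * ((((1 - δ : ℝ)) : ℂ) - 1 / 2)) /
      (1 - b n * (((((1 - δ : ℝ)) : ℂ) - 1 / 2) ^ 2 - 9 / 4))).re := by
  by_cases hb : b n = 0
  · simp [hb]
  have h2 := xiPair_two_ne_zero hχ h1
  have hΞ : xiPair χ (((1 - δ : ℝ)) : ℂ) ≠ 0 := by
    rw [xiPair]
    exact mul_ne_zero (dirichletXi_ne_zero_one_sub hχ h1 hδ)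
      (dirichletXi_ne_zero_of_not_mem_strip
        (by rw [DirichletCharacter.isPrimitive_def, DirichletCharacter.conductor_inv]; exact hχ)
        (inv_ne_one.mpr h1) (Or.inr (by simp only [Complex.ofReal_re]; linarith)))
  have hfac := factor_ne_zero_of_xiPair_ne_zero h2 hprod hΞ n
  rw [re_term_eq_phi hb hfac (Or.inl rfl)]
  obtain ⟨h0, h1'⟩ := re_mem_Ioo_of_xiPair_eq_zero hχ h1 (xiPair_xiPairZero h2 hprod hb)
  exact phi_nonneg h0.le h1'.le hδ

/-- **Lemma 4 / Corollary 5, as an identity over the Hadamard pairs of `Ξ_χ = ξ(·,χ)²`:**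
`2·w_{1,δ} = Σₙ Re[−2bₙz₀/(1 − bₙ(z₀² − 9/4))]`, `z₀ = ½ − δ`, the non-zero terms being `Re[1/(s₀−ρₙ) + 1/(s₀−(1−ρₙ))]`
(`s₀ = 1 − δ ≥ 1`; primitive quadratic `χ ≠ 1`). [cite: HiaryIrelandKyi2026, §4 Lemma 4 (proof: Hadamard product), Corollary 5] -/
theorem two_mul_wOne_eq_tsum (hχ : χ.IsPrimitive) (hquad : χ.IsQuadratic) (h1 : χ ≠ 1) {δ : ℝ} (hδ : δ ≤ 0)
    (hbs : Summable fun n ↦ ‖b n‖)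
    (hprod : ∀ z : ℂ, HasProd (fun n ↦ 1 - b n * (z ^ 2 - 9 / 4)) (xiPair χ (1 / 2 + z) / xiPair χ 2)) :
    2 * wOne χ δ = ∑' n, (-(2 * b n * ((((1 - δ : ℝ)) : ℂ) - 1 / 2)) /
      (1 - b n * (((((1 - δ : ℝ)) : ℂ) - 1 / 2) ^ 2 - 9 / 4))).re := by
  set s₀ : ℂ := ((1 - δ : ℝ) : ℂ) with hs₀
  have h2 := xiPair_two_ne_zero hχ h1
  have hξ0 : dirichletXi χ s₀ ≠ 0 := dirichletXi_ne_zero_one_sub hχ h1 hδ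
  have hΞ0 : xiPair χ (1 / 2 + (s₀ - 1 / 2)) ≠ 0 := by
    rw [add_sub_cancel, xiPair_eq_sq hquad]
    exact pow_ne_zero 2 hξ0
  have hser := logDeriv_xiPair_half_add_eq_tsum hbs h2 hprod hΞ0
  have hcomp : logDeriv (fun w ↦ xiPair χ (1 / 2 + w)) (s₀ - 1 / 2) = logDeriv (xiPair χ) s₀ := by
    have h := logDeriv_comp (f := xiPair χ) (g := fun w : ℂ ↦ 1 / 2 + w) (x := s₀ - 1 / 2)
      ((differentiable_xiPair h1) _) (by fun_prop)
    rw [Function.comp_def] at h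
    rw [h, add_sub_cancel, deriv_const_add, deriv_id'', mul_one]
  have hsq : logDeriv (xiPair χ) s₀ = 2 * logDeriv (dirichletXi χ) s₀ := by
    have hfun : xiPair χ = fun s => dirichletXi χ s ^ 2 := funext (xiPair_eq_sq hquad)
    rw [hfun, logDeriv_fun_pow ((differentiable_dirichletXi h1) s₀) 2]
    push_cast
    ring
  have hsum := summable_logDeriv_factor hbs (9 / 4 : ℂ) (s₀ - 1 / 2)
  calc 2 * wOne χ δ = (2 * logDeriv (dirichletXi χ) s₀).re := by
        rw [← re_logDeriv_dirichletXi_eq_wOne h1 hδ, show (2 : ℂ) = ((2 : ℝ) : ℂ) by norm_num,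
          Complex.re_ofReal_mul]
    _ = (∑' n, -(2 * b n * (s₀ - 1 / 2)) / (1 - b n * ((s₀ - 1 / 2) ^ 2 - 9 / 4))).re := by
        rw [← hsq, ← hcomp, hser]
    _ = _ := Complex.re_tsum hsum

/-- **Lower bound by any finite set of pairs**: `Σ_{k ∈ S} Re[termₖ] ≤ 2 w_{1,δ}` (all terms are `≥ 0`).
[cite: HiaryIrelandKyi2026, §4 (proof of Theorem 7: «any remaining zeros will contribute a nonnegative amount»)] -/
theorem sum_re_term_le_two_mul_wOne (hχ : χ.IsPrimitive) (hquad : χ.IsQuadratic) (h1 : χ ≠ 1) {δ : ℝ}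
    (hδ : δ ≤ 0) (hbs : Summable fun n ↦ ‖b n‖)
    (hprod : ∀ z : ℂ, HasProd (fun n ↦ 1 - b n * (z ^ 2 - 9 / 4)) (xiPair χ (1 / 2 + z) / xiPair χ 2))
    (S : Finset ℕ) :
    ∑ k ∈ S, (-(2 * b k * ((((1 - δ : ℝ)) : ℂ) - 1 / 2)) /
        (1 - b k * (((((1 - δ : ℝ)) : ℂ) - 1 / 2) ^ 2 - 9 / 4))).re ≤ 2 * wOne χ δ := by
  rw [two_mul_wOne_eq_tsum hχ hquad h1 hδ hbs hprod]
  have hsum := summable_logDeriv_factor hbs (9 / 4 : ℂ) ((((1 - δ : ℝ)) : ℂ) - 1 / 2)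
  exact (Complex.hasSum_re hsum.hasSum).summable.sum_le_tsum S fun n _ => re_term_nonneg hχ h1 hδ hprod n

end ZeroSum

/-! ### The pair indices of a zero: finiteness and multiplicity count -/

section Indices

open DirichletTheta

variable {q : ℕ} [NeZero q] {χ : DirichletCharacter ℂ q} {b : ℕ → ℂ}

/-- A summable sequence takes a fixed non-zero value only finitely often. [folklore] -/
private theorem finite_setOf_eq (hbs : Summable fun n ↦ ‖b n‖) {a : ℂ} (ha : a ≠ 0) :
    {k : ℕ | b k = a}.Finite := by
  have ht := (Summable.of_norm hbs).tendsto_cofinite_zero.norm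
  rw [norm_zero] at ht
  have hev : ∀ᶠ k in cofinite, ‖b k‖ < ‖a‖ := ht.eventually (gt_mem_nhds (norm_pos_iff.mpr ha))
  refine (Filter.eventually_cofinite.mp hev).subset fun k hk => ?_
  simp only [Set.mem_setOf_eq] at hk ⊢
  rw [hk]
  exact lt_irrefl _

/-- **The pair indices through a point `ρ`** — `{k : bₖ ≠ 0, ρₖ = ρ or 1 − ρₖ = ρ}` — form a finite set
(`bₖ = 1/((ρ − ½)² − 9/4)` on it, and `bₖ → 0`). [cite: Conway1978, Ch. XI Thm. 3.4] -/
theorem finite_index (hbs : Summable fun n ↦ ‖b n‖) (ρ : ℂ) :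
    {k : ℕ | b k ≠ 0 ∧ (xiPairZero b k = ρ ∨ 1 - xiPairZero b k = ρ)}.Finite := by
  have key : ∀ k, b k ≠ 0 → (xiPairZero b k = ρ ∨ 1 - xiPairZero b k = ρ) →
      (b k)⁻¹ = (ρ - 1 / 2) ^ 2 - 9 / 4 := by
    intro k _ h
    have hsq := xiPairZero_sub_half_sq'' b k
    rcases h with h | h
    · rw [← h, hsq]; ring
    · rw [← h, show (1 - xiPairZero b k - 1 / 2) ^ 2 = (xiPairZero b k - 1 / 2) ^ 2 by ring, hsq]; ring
  by_cases hc : (ρ - 1 / 2) ^ 2 - 9 / 4 = 0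
  · refine Set.finite_empty.subset fun k hk => ?_
    exact hk.1 (inv_eq_zero.mp ((key k hk.1 hk.2).trans hc))
  · refine (finite_setOf_eq hbs (inv_ne_zero hc)).subset fun k hk => ?_
    show b k = ((ρ - 1 / 2) ^ 2 - 9 / 4)⁻¹
    rw [← key k hk.1 hk.2, inv_inv]

/-- **Multiplicity count off the centre:** for a zero `ρ ≠ ½` of `Ξ_χ` (primitive quadratic `χ ≠ 1`), the pair indices
through `ρ` number `m_χ(ρ) + m_χ̄(ρ) = 2 m_χ(ρ)`. [cite: HiaryIrelandKyi2026, §4 (proof of Theorem 7: zeros counted with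
multiplicity); Conway1978, Ch. XI Thm. 3.4] -/
theorem card_index_eq_two_mul (hχ : χ.IsPrimitive) (hquad : χ.IsQuadratic) (h1 : χ ≠ 1)
    (hbs : Summable fun n ↦ ‖b n‖)
    (hmult : ∀ a : ℂ, a ≠ 0 → {n : ℕ | b n = a⁻¹}.ncard = analyticOrderNatAt (fun w ↦ xiPairLift χ (w + 9 / 4)) a)
    {ρ : ℂ} (hΞ : xiPair χ ρ = 0) (hne : ρ ≠ 1 / 2) :
    (finite_index hbs ρ).toFinset.card = 2 * DirichletDisc.zeroOrder χ ρ := by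
  have hcount := ncard_index_add_ncard_index_eq hχ h1 hmult hΞ
  rw [hquad.inv, ← two_mul] at hcount
  set A := {k : ℕ | b k ≠ 0 ∧ xiPairZero b k = ρ} with hA
  set B := {k : ℕ | b k ≠ 0 ∧ 1 - xiPairZero b k = ρ} with hB
  have hI : {k : ℕ | b k ≠ 0 ∧ (xiPairZero b k = ρ ∨ 1 - xiPairZero b k = ρ)} = A ∪ B := by
    ext k
    simp only [hA, hB, Set.mem_setOf_eq, Set.mem_union, and_or_left]
  have hfin := finite_index hbs ρ
  have hAfin : A.Finite := hfin.subset (by rw [hI]; exact Set.subset_union_left)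
  have hBfin : B.Finite := hfin.subset (by rw [hI]; exact Set.subset_union_right)
  have hdisj : Disjoint A B := by
    rw [Set.disjoint_left]
    rintro k ⟨-, hk1⟩ ⟨-, hk2⟩
    rw [hk1] at hk2
    apply hne
    linear_combination (-1 / 2 : ℂ) * hk2
  rw [← Set.ncard_eq_toFinset_card _ hfin]
  simp only [hI]
  rw [Set.ncard_union_eq hdisj hAfin hBfin, hcount]

/-- **Multiplicity count at the centre:** the pair indices through `ρ = ½` number `m_χ(½)` (`ρₖ = ½ ↔ 1 − ρₖ = ½`).
[cite: HiaryIrelandKyi2026, §4 (proof of Theorem 7 (iv)); Conway1978, Ch. XI Thm. 3.4] -/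
theorem card_index_half_eq (hχ : χ.IsPrimitive) (hquad : χ.IsQuadratic) (h1 : χ ≠ 1)
    (hbs : Summable fun n ↦ ‖b n‖)
    (hmult : ∀ a : ℂ, a ≠ 0 → {n : ℕ | b n = a⁻¹}.ncard = analyticOrderNatAt (fun w ↦ xiPairLift χ (w + 9 / 4)) a)
    (hΞ : xiPair χ (1 / 2) = 0) :
    (finite_index hbs (1 / 2 : ℂ)).toFinset.card = DirichletDisc.zeroOrder χ (1 / 2) := by
  have hcount := ncard_index_add_ncard_index_eq hχ h1 hmult hΞ
  rw [hquad.inv, ← two_mul] at hcount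
  have hB : {k : ℕ | b k ≠ 0 ∧ 1 - xiPairZero b k = 1 / 2} = {k : ℕ | b k ≠ 0 ∧ xiPairZero b k = 1 / 2} := by
    ext k
    simp only [Set.mem_setOf_eq]
    constructor
    · rintro ⟨hb, h⟩; exact ⟨hb, by linear_combination -h⟩
    · rintro ⟨hb, h⟩; exact ⟨hb, by linear_combination -h⟩
  have hI : {k : ℕ | b k ≠ 0 ∧ (xiPairZero b k = 1 / 2 ∨ 1 - xiPairZero b k = 1 / 2)} =
      {k : ℕ | b k ≠ 0 ∧ xiPairZero b k = 1 / 2} := by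
    ext k
    simp only [Set.mem_setOf_eq]
    constructor
    · rintro ⟨hb, h | h⟩
      · exact ⟨hb, h⟩
      · exact ⟨hb, by linear_combination -h⟩
    · rintro ⟨hb, h⟩; exact ⟨hb, Or.inl h⟩
  rw [hB, ← two_mul] at hcount
  have hc : {k : ℕ | b k ≠ 0 ∧ xiPairZero b k = 1 / 2}.ncard = DirichletDisc.zeroOrder χ (1 / 2) := by omega
  rw [← Set.ncard_eq_toFinset_card _ (finite_index hbs _)]
  simp only [hI]
  exact hc

end Indices

/-! ### Theorem 7 -/

section MainTheorem

open DirichletTheta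

variable {q : ℕ} [NeZero q] {χ : DirichletCharacter ℂ q}

/-- **A sign change of the real function `ξ(½ + it, χ)` on `[γ₋, γ₊] ⊆ [0, ∞)` yields a zero `½ + it`, `t ∈ [γ₋, γ₊]`,
`t > 0`** (intermediate value theorem). [cite: HiaryIrelandKyi2026, §4 Theorem 7 (hypothesis «ξ_L(1/2 + iτ₁) < 0 < ξ_L(1/2 + iτ₂)»)] -/
theorem exists_zero_of_signChange (hχ : χ.IsPrimitive) (hquad : χ.IsQuadratic) (h1 : χ ≠ 1)
    {P : ℝ × ℝ} (hP0 : 0 ≤ P.1)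
    (h : ∃ τ₁ ∈ Set.Icc P.1 P.2, ∃ τ₂ ∈ Set.Icc P.1 P.2,
      (dirichletXi χ (1 / 2 + τ₁ * I)).re < 0 ∧ 0 < (dirichletXi χ (1 / 2 + τ₂ * I)).re) :
    ∃ t ∈ Set.Icc P.1 P.2, 0 < t ∧ dirichletXi χ (1 / 2 + t * I) = 0 := by
  obtain ⟨τ₁, hτ₁, τ₂, hτ₂, hneg, hpos⟩ := h
  set f : ℝ → ℝ := fun t => (dirichletXi χ (1 / 2 + t * I)).re with hf
  have hcont : Continuous f := by
    have hc : Continuous (dirichletXi χ) := (differentiable_dirichletXi h1).continuous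
    exact Complex.continuous_re.comp (hc.comp (by fun_prop))
  have h0mem : (0 : ℝ) ∈ Set.uIcc (f τ₁) (f τ₂) := by
    rw [Set.mem_uIcc]; left; exact ⟨hneg.le, hpos.le⟩
  obtain ⟨t, ht, hft⟩ := intermediate_value_uIcc (a := τ₁) (b := τ₂) hcont.continuousOn h0mem
  have htI : t ∈ Set.Icc P.1 P.2 := Set.uIcc_subset_Icc hτ₁ hτ₂ ht
  have ht1 : t ≠ τ₁ := fun h => by rw [h] at hft; linarith
  have ht2 : t ≠ τ₂ := fun h => by rw [h] at hft; linarith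
  have hlt : min τ₁ τ₂ < t := by
    rcases Set.mem_uIcc.mp ht with ⟨ha, -⟩ | ⟨ha, -⟩
    · exact lt_of_le_of_lt (min_le_left _ _) (lt_of_le_of_ne ha (Ne.symm ht1))
    · exact lt_of_le_of_lt (min_le_right _ _) (lt_of_le_of_ne ha (Ne.symm ht2))
  have hmin0 : 0 ≤ min τ₁ τ₂ := le_min (hP0.trans hτ₁.1) (hP0.trans hτ₂.1)
  refine ⟨t, htI, hmin0.trans_lt hlt, ?_⟩
  apply Complex.ext
  · simpa [hf] using hft
  · rw [dirichletXi_criticalLine_im_eq_zero_of_isQuadratic hχ h1 hquad t, Complex.zero_im]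

variable {b : ℕ → ℂ}

/-- **The block of a zero.**  For a zero `ρ` of `ξ(·, χ)` the pair indices through `ρ` form a finite set `E` on which
every term equals `φ(Re ρ, Im ρ, δ)`; `|E| = 2 m_χ(ρ) ≥ 2` if `ρ ≠ ½`, `|E| = m_χ(½) ≥ 1` if `ρ = ½`.
[cite: HiaryIrelandKyi2026, §4 (proof of Theorem 7)] -/
theorem sum_index_eq (hχ : χ.IsPrimitive) (hquad : χ.IsQuadratic) (h1 : χ ≠ 1) {δ : ℝ} (hδ : δ ≤ 0)
    (hbs : Summable fun n ↦ ‖b n‖)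
    (hmult : ∀ a : ℂ, a ≠ 0 → {n : ℕ | b n = a⁻¹}.ncard = analyticOrderNatAt (fun w ↦ xiPairLift χ (w + 9 / 4)) a)
    (hprod : ∀ z : ℂ, HasProd (fun n ↦ 1 - b n * (z ^ 2 - 9 / 4)) (xiPair χ (1 / 2 + z) / xiPair χ 2))
    {ρ : ℂ} (hξ : dirichletXi χ ρ = 0) :
    (∑ k ∈ (finite_index hbs ρ).toFinset, (-(2 * b k * ((((1 - δ : ℝ)) : ℂ) - 1 / 2)) /
        (1 - b k * (((((1 - δ : ℝ)) : ℂ) - 1 / 2) ^ 2 - 9 / 4))).re) = (finite_index hbs ρ).toFinset.card * phi ρ.re ρ.im δ ∧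
    (ρ ≠ 1 / 2 → 2 ≤ (finite_index hbs ρ).toFinset.card) ∧
    (ρ = 1 / 2 → 1 ≤ (finite_index hbs ρ).toFinset.card) := by
  have h2 := xiPair_two_ne_zero hχ h1
  have hΞ0 : xiPair χ (((1 - δ : ℝ)) : ℂ) ≠ 0 := by
    rw [xiPair_eq_sq hquad]; exact pow_ne_zero 2 (dirichletXi_ne_zero_one_sub hχ h1 hδ)
  have hΞ : xiPair χ ρ = 0 := by rw [xiPair_eq_sq hquad, hξ]; simp
  have hL : χ.LFunction ρ = 0 :=
    (ExplicitPsiChar.mem_charNontrivialZeros.1 ((dirichletXi_eq_zero_iff_mem_charNontrivialZeros hχ h1 ρ).1 hξ)).1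
  have hm : 0 < DirichletDisc.zeroOrder χ ρ := (DirichletDisc.zeroOrder_pos_iff χ h1 ρ).2 hL
  refine ⟨?_, fun hne => ?_, fun heq => ?_⟩
  · rw [Finset.sum_congr rfl fun k hk => ?_, Finset.sum_const, nsmul_eq_mul]
    obtain ⟨hb, hk'⟩ := (Set.Finite.mem_toFinset _).1 hk
    exact re_term_eq_phi hb (factor_ne_zero_of_xiPair_ne_zero h2 hprod hΞ0 k) hk'
  · rw [card_index_eq_two_mul hχ hquad h1 hbs hmult hΞ hne]; omega
  · subst heq
    rw [card_index_half_eq hχ hquad h1 hbs hmult hΞ]; omega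

/-- **The known zeros.**  Under the sign-change data `𝒵` of Theorem 7 there is a finite set `U` of pair indices, all with
`Re ρₖ = ½`, `Im ρₖ ≠ 0`, whose terms sum to at least `2·C(𝒵, δ)` (each interval carries a zero `½ + it`, `0 < t ≤ γ₊`, of
multiplicity `≥ 1`, i.e. `≥ 2` pair indices of value `φ(½, t, δ) ≥ (1 − 2δ)/((½ − δ)² + γ₊²)`; distinct intervals give
disjoint index sets). [cite: HiaryIrelandKyi2026, §4 (proof of Theorem 7: «the zeros from the set 𝒵 already contribute at
least C(𝒵, δ)»)] -/
theorem exists_knownZeros (hχ : χ.IsPrimitive) (hquad : χ.IsQuadratic) (h1 : χ ≠ 1) {δ : ℝ} (hδ : δ ≤ 0)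
    {τ : ℝ} {Z : Finset (ℝ × ℝ)} (hZ : IsSignChangeData χ τ Z) (hbs : Summable fun n ↦ ‖b n‖)
    (hmult : ∀ a : ℂ, a ≠ 0 → {n : ℕ | b n = a⁻¹}.ncard = analyticOrderNatAt (fun w ↦ xiPairLift χ (w + 9 / 4)) a)
    (hprod : ∀ z : ℂ, HasProd (fun n ↦ 1 - b n * (z ^ 2 - 9 / 4)) (xiPair χ (1 / 2 + z) / xiPair χ 2)) :
    ∃ U : Finset ℕ, (∀ k ∈ U, b k ≠ 0 ∧ (xiPairZero b k).re = 1 / 2 ∧ (xiPairZero b k).im ≠ 0) ∧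
      2 * C Z δ ≤ ∑ k ∈ U, (-(2 * b k * ((((1 - δ : ℝ)) : ℂ) - 1 / 2)) /
        (1 - b k * (((((1 - δ : ℝ)) : ℂ) - 1 / 2) ^ 2 - 9 / 4))).re := by
  obtain ⟨hZ1, hZ2, hZ3⟩ := hZ
  have key : ∀ P ∈ Z, ∃ t ∈ Set.Icc P.1 P.2, 0 < t ∧ dirichletXi χ (1 / 2 + t * I) = 0 :=
    fun P hP => exists_zero_of_signChange hχ hquad h1 (hZ1 P hP).1 (hZ3 P hP)
  choose! t ht using key
  set F : ℝ × ℝ → Finset ℕ := fun P => (finite_index hbs (1 / 2 + t P * I)).toFinset with hF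
  have hFmem : ∀ P k, k ∈ F P ↔
      b k ≠ 0 ∧ (xiPairZero b k = 1 / 2 + t P * I ∨ 1 - xiPairZero b k = 1 / 2 + t P * I) :=
    fun P k => Set.Finite.mem_toFinset _
  have hblock : ∀ P ∈ Z, (∑ k ∈ F P, (-(2 * b k * ((((1 - δ : ℝ)) : ℂ) - 1 / 2)) /
        (1 - b k * (((((1 - δ : ℝ)) : ℂ) - 1 / 2) ^ 2 - 9 / 4))).re) = (F P).card * phi (1 / 2) (t P) δ ∧ 2 ≤ (F P).card := by
    intro P hP
    obtain ⟨hsum, hcard, -⟩ := sum_index_eq hχ hquad h1 hδ hbs hmult hprod (ht P hP).2.2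
    have hne : (1 / 2 + t P * I : ℂ) ≠ 1 / 2 := by
      intro h
      have := congrArg Complex.im h
      simp at this
      exact (ht P hP).2.1.ne' this
    refine ⟨?_, hcard hne⟩
    rw [hsum]
    congr 1
    congr 1 <;> simp
  have hdisj : (Z : Set (ℝ × ℝ)).PairwiseDisjoint F := by
    intro P hP Q hQ hPQ
    rw [Function.onFun, Finset.disjoint_left]
    intro k hkP hkQ
    obtain ⟨-, hP'⟩ := (hFmem P k).1 hkP
    obtain ⟨-, hQ'⟩ := (hFmem Q k).1 hkQ
    have htP := (ht P hP).2.1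
    have htQ := (ht Q hQ).2.1
    have heq : t P = t Q := by
      rcases hP' with h | h <;> rcases hQ' with h' | h'
      · have := congrArg Complex.im (h.symm.trans h'); simpa using this
      · exfalso
        have := congrArg Complex.im ((congrArg (fun z => 1 - z) h).symm.trans h')
        simp at this; linarith
      · exfalso
        have := congrArg Complex.im ((congrArg (fun z => 1 - z) h').symm.trans h)
        simp at this; linarith
      · have := congrArg Complex.im (h.symm.trans h'); simpa using this
    have hmemP := (ht P hP).1
    have hmemQ := (ht Q hQ).1
    rw [heq] at hmemP
    exact Set.disjoint_left.mp (hZ2 P hP Q hQ hPQ) hmemP hmemQ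
  refine ⟨Z.biUnion F, fun k hk => ?_, ?_⟩
  · obtain ⟨P, hP, hkP⟩ := Finset.mem_biUnion.mp hk
    obtain ⟨hb, hk'⟩ := (hFmem P k).1 hkP
    have htP := (ht P hP).2.1
    have hρk : xiPairZero b k = 1 / 2 + t P * I ∨ xiPairZero b k = 1 - (1 / 2 + t P * I) := by
      rcases hk' with h | h
      · exact Or.inl h
      · exact Or.inr (by rw [← h]; ring)
    refine ⟨hb, ?_, ?_⟩
    · rcases hρk with h | h
      · rw [h]; norm_num
      · rw [h]; norm_num
    · rcases hρk with h | h
      · rw [h]; simpa using htP.ne'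
      · rw [h]; simpa using htP.ne'
  · rw [Finset.sum_biUnion hdisj, C, Finset.mul_sum]
    refine Finset.sum_le_sum fun P hP => ?_
    obtain ⟨hsum, hcard⟩ := hblock P hP
    rw [hsum, phi_half]
    have hc : (2 : ℝ) ≤ (F P).card := by exact_mod_cast hcard
    have htP0 := (ht P hP).2.1
    have htP2 : t P ≤ P.2 := (ht P hP).1.2
    have hnum : 0 ≤ 1 - 2 * δ := by linarith
    have hY : 0 ≤ (1 - 2 * δ) / ((1 / 2 - δ) ^ 2 + t P ^ 2) := div_nonneg hnum (by positivity)
    have hA : (1 - 2 * δ) / ((1 / 2 - δ) ^ 2 + P.2 ^ 2) ≤ (1 - 2 * δ) / ((1 / 2 - δ) ^ 2 + t P ^ 2) :=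
      div_le_div_of_nonneg_left hnum (by positivity) (by nlinarith)
    calc 2 * ((1 - 2 * δ) / ((1 / 2 - δ) ^ 2 + P.2 ^ 2))
        ≤ 2 * ((1 - 2 * δ) / ((1 / 2 - δ) ^ 2 + t P ^ 2)) := by gcongr
      _ ≤ (F P).card * ((1 - 2 * δ) / ((1 / 2 - δ) ^ 2 + t P ^ 2)) := mul_le_mul_of_nonneg_right hc hY

end MainTheorem

/-! ### Corollary 1: odd-multiplicity zeros instead of sign changes -/

section CorollaryOne

open DirichletTheta

variable {q : ℕ} [NeZero q] {χ : DirichletCharacter ℂ q}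

/-- **`ord_{s=½} L(s, χ)` is even for a primitive quadratic `χ`** (`ξ(s, χ) = ξ(1 − s, χ)` as `ε(χ) = 1`, `χ̄ = χ`;
the tree's parity mechanism `CentralOrder.even_analyticOrderNatAt_of_eventually`).  Hence `L(½ + it, χ_d)` cannot have a
zero of odd multiplicity at `t = 0` — the reason Corollary 1 may take `[γ₋, γ₊] ⊆ [0, τ]` closed at `0`.
[cite: HiaryIrelandKyi2026, §4 («if ε = ±1 … ξ_L(1/2 + it) is even in t»)] -/
theorem even_zeroOrder_half (hχ : χ.IsPrimitive) (hquad : χ.IsQuadratic) (h1 : χ ≠ 1) :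
    Even (DirichletDisc.zeroOrder χ (1 / 2)) := by
  have hFE : ∀ᶠ s in 𝓝 (1 / 2 : ℂ), dirichletXi χ (1 - s) = 1 * dirichletXi χ s := by
    refine Filter.Eventually.of_forall fun s => ?_
    have h := dirichletXi_eq_rootNumber_mul_dirichletXi_inv_one_sub hχ s
    rw [PrimitiveQuadratic.rootNumber_eq_one_of_isQuadratic hχ hquad, hquad.inv, one_mul] at h
    rw [← h, one_mul]
  have hev := CentralOrder.even_analyticOrderNatAt_of_eventually
    ((differentiable_dirichletXi h1).analyticAt (1 / 2)) hFE (by norm_num)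
  have hord := analyticOrderAt_dirichletXi_eq_zeroOrder h1 (ρ := 1 / 2) (by norm_num)
  have : analyticOrderNatAt (dirichletXi χ) (1 / 2) = DirichletDisc.zeroOrder χ (1 / 2) := by
    rw [analyticOrderNatAt, hord, ENat.toNat_coe]
  rwa [this] at hev

variable {b : ℕ → ℂ}

/-- **The known zeros, from zeros** (Corollary 1's data): if each interval `[γ₋, γ₊]` of `𝒵` (pairwise disjoint) carries a
zero `½ + it`, `t ∈ [γ₋, γ₊]`, `t > 0`, of `ξ(·, χ)`, there is a finite set `U` of pair indices, all with `Re ρₖ = ½`,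
`Im ρₖ ≠ 0`, with `Σ_U ≥ 2·C(𝒵, δ)`. [cite: HiaryIrelandKyi2026, §4 (proof of Theorem 7: «the zeros from the set 𝒵 already
contribute at least C(𝒵, δ)»); §1 Corollary 1] -/
theorem exists_knownZeros_of_zeros (hχ : χ.IsPrimitive) (hquad : χ.IsQuadratic) (h1 : χ ≠ 1) {δ : ℝ} (hδ : δ ≤ 0)
    {Z : Finset (ℝ × ℝ)} (hZ2 : ∀ P ∈ Z, ∀ Q ∈ Z, P ≠ Q → Disjoint (Set.Icc P.1 P.2) (Set.Icc Q.1 Q.2))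
    (key : ∀ P ∈ Z, ∃ t ∈ Set.Icc P.1 P.2, 0 < t ∧ dirichletXi χ (1 / 2 + t * I) = 0)
    (hbs : Summable fun n ↦ ‖b n‖)
    (hmult : ∀ a : ℂ, a ≠ 0 → {n : ℕ | b n = a⁻¹}.ncard = analyticOrderNatAt (fun w ↦ xiPairLift χ (w + 9 / 4)) a)
    (hprod : ∀ z : ℂ, HasProd (fun n ↦ 1 - b n * (z ^ 2 - 9 / 4)) (xiPair χ (1 / 2 + z) / xiPair χ 2)) :
    ∃ U : Finset ℕ, (∀ k ∈ U, b k ≠ 0 ∧ (xiPairZero b k).re = 1 / 2 ∧ (xiPairZero b k).im ≠ 0) ∧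
      2 * C Z δ ≤ ∑ k ∈ U, (-(2 * b k * ((((1 - δ : ℝ)) : ℂ) - 1 / 2)) /
        (1 - b k * (((((1 - δ : ℝ)) : ℂ) - 1 / 2) ^ 2 - 9 / 4))).re := by
  choose! t ht using key
  set F : ℝ × ℝ → Finset ℕ := fun P => (finite_index hbs (1 / 2 + t P * I)).toFinset with hF
  have hFmem : ∀ P k, k ∈ F P ↔
      b k ≠ 0 ∧ (xiPairZero b k = 1 / 2 + t P * I ∨ 1 - xiPairZero b k = 1 / 2 + t P * I) :=
    fun P k => Set.Finite.mem_toFinset _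
  have hblock : ∀ P ∈ Z, (∑ k ∈ F P, (-(2 * b k * ((((1 - δ : ℝ)) : ℂ) - 1 / 2)) /
        (1 - b k * (((((1 - δ : ℝ)) : ℂ) - 1 / 2) ^ 2 - 9 / 4))).re) = (F P).card * phi (1 / 2) (t P) δ ∧ 2 ≤ (F P).card := by
    intro P hP
    obtain ⟨hsum, hcard, -⟩ := sum_index_eq hχ hquad h1 hδ hbs hmult hprod (ht P hP).2.2
    have hne : (1 / 2 + t P * I : ℂ) ≠ 1 / 2 := by
      intro h
      have := congrArg Complex.im h
      simp at this
      exact (ht P hP).2.1.ne' this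
    refine ⟨?_, hcard hne⟩
    rw [hsum]
    congr 1
    congr 1 <;> simp
  have hdisj : (Z : Set (ℝ × ℝ)).PairwiseDisjoint F := by
    intro P hP Q hQ hPQ
    rw [Function.onFun, Finset.disjoint_left]
    intro k hkP hkQ
    obtain ⟨-, hP'⟩ := (hFmem P k).1 hkP
    obtain ⟨-, hQ'⟩ := (hFmem Q k).1 hkQ
    have htP := (ht P hP).2.1
    have htQ := (ht Q hQ).2.1
    have heq : t P = t Q := by
      rcases hP' with h | h <;> rcases hQ' with h' | h'
      · have := congrArg Complex.im (h.symm.trans h'); simpa using this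
      · exfalso
        have := congrArg Complex.im ((congrArg (fun z => 1 - z) h).symm.trans h')
        simp at this; linarith
      · exfalso
        have := congrArg Complex.im ((congrArg (fun z => 1 - z) h').symm.trans h)
        simp at this; linarith
      · have := congrArg Complex.im (h.symm.trans h'); simpa using this
    have hmemP := (ht P hP).1
    have hmemQ := (ht Q hQ).1
    rw [heq] at hmemP
    exact Set.disjoint_left.mp (hZ2 P hP Q hQ hPQ) hmemP hmemQ
  refine ⟨Z.biUnion F, fun k hk => ?_, ?_⟩
  · obtain ⟨P, hP, hkP⟩ := Finset.mem_biUnion.mp hk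
    obtain ⟨hb, hk'⟩ := (hFmem P k).1 hkP
    have htP := (ht P hP).2.1
    have hρk : xiPairZero b k = 1 / 2 + t P * I ∨ xiPairZero b k = 1 - (1 / 2 + t P * I) := by
      rcases hk' with h | h
      · exact Or.inl h
      · exact Or.inr (by rw [← h]; ring)
    refine ⟨hb, ?_, ?_⟩
    · rcases hρk with h | h
      · rw [h]; norm_num
      · rw [h]; norm_num
    · rcases hρk with h | h
      · rw [h]; simpa using htP.ne'
      · rw [h]; simpa using htP.ne'
  · rw [Finset.sum_biUnion hdisj, C, Finset.mul_sum]
    refine Finset.sum_le_sum fun P hP => ?_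
    obtain ⟨hsum, hcard⟩ := hblock P hP
    rw [hsum, phi_half]
    have hc : (2 : ℝ) ≤ (F P).card := by exact_mod_cast hcard
    have htP0 := (ht P hP).2.1
    have htP2 : t P ≤ P.2 := (ht P hP).1.2
    have hnum : 0 ≤ 1 - 2 * δ := by linarith
    have hY : 0 ≤ (1 - 2 * δ) / ((1 / 2 - δ) ^ 2 + t P ^ 2) := div_nonneg hnum (by positivity)
    have hA : (1 - 2 * δ) / ((1 / 2 - δ) ^ 2 + P.2 ^ 2) ≤ (1 - 2 * δ) / ((1 / 2 - δ) ^ 2 + t P ^ 2) :=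
      div_le_div_of_nonneg_left hnum (by positivity) (by nlinarith)
    calc 2 * ((1 - 2 * δ) / ((1 / 2 - δ) ^ 2 + P.2 ^ 2))
        ≤ 2 * ((1 - 2 * δ) / ((1 / 2 - δ) ^ 2 + t P ^ 2)) := by gcongr
      _ ≤ (F P).card * ((1 - 2 * δ) / ((1 / 2 - δ) ^ 2 + t P ^ 2)) := mul_le_mul_of_nonneg_right hc hY

/-- **Corollary 1's zero data yield the zeros**: an odd-multiplicity zero `½ + it` of `L(s, χ)` with `t ∈ [γ₋, γ₊] ⊆ [0, τ]`
has `t > 0` (the order at the centre is even) and is a zero of `ξ(·, χ)`. [cite: HiaryIrelandKyi2026, §1 Corollary 1] -/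
theorem zeros_of_isOddZeroData (hχ : χ.IsPrimitive) (hquad : χ.IsQuadratic) (h1 : χ ≠ 1) {τ : ℝ}
    {Z : Finset (ℝ × ℝ)} (hZ : IsOddZeroData χ τ Z) :
    ∀ P ∈ Z, ∃ t ∈ Set.Icc P.1 P.2, 0 < t ∧ dirichletXi χ (1 / 2 + t * I) = 0 := by
  obtain ⟨hZ1, -, hZ3⟩ := hZ
  intro P hP
  obtain ⟨t, htI, hL, hodd⟩ := hZ3 P hP
  have ht0 : 0 ≤ t := (hZ1 P hP).1.trans htI.1
  have htne : t ≠ 0 := by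
    rintro rfl
    have h : (1 / 2 + (0 : ℝ) * I : ℂ) = 1 / 2 := by simp
    rw [h] at hodd
    exact (Nat.not_even_iff_odd.mpr hodd) (even_zeroOrder_half hχ hquad h1)
  refine ⟨t, htI, lt_of_le_of_ne ht0 (Ne.symm htne), ?_⟩
  exact (dirichletXi_eq_zero_iff_mem_charNontrivialZeros hχ h1 _).2 ⟨hL, by simp, by norm_num⟩

/-- **Theorem 7 (i), core form**: given the known-zeros block `U` (all `Re ρₖ = ½`) with `Σ_U ≥ 2·C(𝒵, δ)` and
`w_{1,δ} < f₁(η, δ, 1) + C(𝒵, δ)`, every zero with `0 < |Im ρ| ≤ η` lies on the critical line.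
[cite: HiaryIrelandKyi2026, §4 Theorem 7 (i) (proof)] -/
theorem noOffLine_of_knownZeros (hχ : χ.IsPrimitive) (hquad : χ.IsQuadratic) (h1 : χ ≠ 1) {δ : ℝ} (hδ : δ ≤ 0)
    {Z : Finset (ℝ × ℝ)} (hbs : Summable fun n ↦ ‖b n‖)
    (hmult : ∀ a : ℂ, a ≠ 0 → {n : ℕ | b n = a⁻¹}.ncard = analyticOrderNatAt (fun w ↦ xiPairLift χ (w + 9 / 4)) a)
    (hprod : ∀ z : ℂ, HasProd (fun n ↦ 1 - b n * (z ^ 2 - 9 / 4)) (xiPair χ (1 / 2 + z) / xiPair χ 2))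
    {U : Finset ℕ} (hU : ∀ k ∈ U, b k ≠ 0 ∧ (xiPairZero b k).re = 1 / 2 ∧ (xiPairZero b k).im ≠ 0)
    (hUsum : 2 * C Z δ ≤ ∑ k ∈ U, (-(2 * b k * ((((1 - δ : ℝ)) : ℂ) - 1 / 2)) /
        (1 - b k * (((((1 - δ : ℝ)) : ℂ) - 1 / 2) ^ 2 - 9 / 4))).re)
    {η : ℝ} (hη : 0 < η) (hineq : wOne χ δ < 2 * min (phi 0 η δ) (phi (1 / 2) η δ) + C Z δ)
    {ρ : ℂ} (hL : χ.LFunction ρ = 0) (hre0 : 0 < ρ.re) (hre1 : ρ.re < 1) (him : ρ.im ≠ 0) (hη' : |ρ.im| ≤ η) :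
    ρ.re = 1 / 2 := by
  have bound : ∀ E : Finset ℕ, Disjoint E U →
      (∑ k ∈ E, (-(2 * b k * ((((1 - δ : ℝ)) : ℂ) - 1 / 2)) /
        (1 - b k * (((((1 - δ : ℝ)) : ℂ) - 1 / 2) ^ 2 - 9 / 4))).re) + 2 * C Z δ ≤ 2 * wOne χ δ := by
    intro E hE
    have h := sum_re_term_le_two_mul_wOne hχ hquad h1 hδ hbs hprod (E ∪ U)
    rw [Finset.sum_union hE] at h
    linarith
  have hmemE : ∀ (ρ : ℂ) (k : ℕ), k ∈ (finite_index hbs ρ).toFinset →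
      xiPairZero b k = ρ ∨ xiPairZero b k = 1 - ρ := by
    intro ρ k hk
    obtain ⟨-, h | h⟩ := (Set.Finite.mem_toFinset _).1 hk
    · exact Or.inl h
    · exact Or.inr (by rw [← h]; ring)
  have hdisjU : ∀ ρ : ℂ, ρ.re ≠ 1 / 2 → Disjoint (finite_index hbs ρ).toFinset U := by
    intro ρ hρ
    rw [Finset.disjoint_left]
    intro k hk hkU
    obtain ⟨-, hre, -⟩ := hU k hkU
    rcases hmemE ρ k hk with h | h
    · exact hρ (by rw [← h, hre])
    · apply hρ
      have := congrArg Complex.re h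
      rw [hre, Complex.sub_re, Complex.one_re] at this
      linarith
  by_contra hβ
  have hξ : dirichletXi χ ρ = 0 := (dirichletXi_eq_zero_iff_mem_charNontrivialZeros hχ h1 ρ).2 ⟨hL, hre0, hre1⟩
  have hξ' : dirichletXi χ (conj ρ) = 0 := by
    have h : xiPair χ (conj ρ) = 0 := by
      rw [← conj_xiPair h1, xiPair_eq_sq hquad, hξ]; simp
    rw [xiPair_eq_sq hquad] at h
    exact pow_eq_zero_iff (n := 2) two_ne_zero |>.1 h
  obtain ⟨hs1, hc1, -⟩ := sum_index_eq hχ hquad h1 hδ hbs hmult hprod hξ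
  obtain ⟨hs2, hc2, -⟩ := sum_index_eq hχ hquad h1 hδ hbs hmult hprod hξ'
  set E₁ := (finite_index hbs ρ).toFinset with hE₁
  set E₂ := (finite_index hbs (conj ρ)).toFinset with hE₂
  have hne1 : ρ ≠ 1 / 2 := fun h => him (by rw [h]; simp)
  have hne2 : conj ρ ≠ 1 / 2 := fun h => him (by have := congrArg Complex.im h; simpa using this)
  have h12 : Disjoint E₁ E₂ := by
    rw [Finset.disjoint_left]
    intro k hk1 hk2
    rcases hmemE ρ k hk1 with h | h <;> rcases hmemE (conj ρ) k hk2 with h' | h'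
    · exact him (by have := congrArg Complex.im (h.symm.trans h'); simp at this; linarith)
    · exact hβ (by have := congrArg Complex.re (h.symm.trans h'); simp at this; linarith)
    · exact hβ (by have := congrArg Complex.re (h.symm.trans h'); simp at this; linarith)
    · exact him (by have := congrArg Complex.im (h.symm.trans h'); simp at this; linarith)
  have hdU : Disjoint (E₁ ∪ E₂) U := by
    rw [Finset.disjoint_union_left]
    exact ⟨hdisjU ρ hβ, hdisjU (conj ρ) (by simpa using hβ)⟩
  have hb := bound (E₁ ∪ E₂) hdU
  rw [Finset.sum_union h12, hs1, hs2] at hb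
  have hc1' : (2 : ℝ) ≤ E₁.card := by exact_mod_cast hc1 hne1
  have hc2' : (2 : ℝ) ≤ E₂.card := by exact_mod_cast hc2 hne2
  have hφ' : phi (conj ρ).re (conj ρ).im δ = phi ρ.re ρ.im δ := by
    rw [Complex.conj_re, Complex.conj_im, phi_neg_eta]
  rw [hφ'] at hb
  have hφ0 : 0 ≤ phi ρ.re ρ.im δ := phi_nonneg hre0.le hre1.le hδ
  have hmono : phi ρ.re η δ ≤ phi ρ.re ρ.im δ :=
    phi_le_phi_of_sq_le hre0.le hre1.le hδ him (by nlinarith [abs_le.mp hη', sq_abs ρ.im])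
  have hmin := min_phi_le (η := η) hre0.le hre1.le hδ hη
  nlinarith

end CorollaryOne

/-! ### Theorem 7 with multiplicity: general `m` -/

section GeneralMultiplicity

open DirichletTheta

variable {q : ℕ} [NeZero q] {χ : DirichletCharacter ℂ q} {b : ℕ → ℂ}

/-- **Double counting of pair indices over a finite set of zeros off the centre**: each index lies in the blocks of at most
two points (`ρₖ` and `1 − ρₖ`), and the block of `ρ` has `2 m_χ(ρ)` elements; hence
`Σ_{ρ ∈ S} m_χ(ρ) ≤ |⋃_{ρ ∈ S} block(ρ)|`. [cite: HiaryIrelandKyi2026, §4 Theorem 7 («zeros are counted with multiplicity in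
all cases»)] -/
theorem sum_zeroOrder_le_card_biUnion (hχ : χ.IsPrimitive) (hquad : χ.IsQuadratic) (h1 : χ ≠ 1)
    (hbs : Summable fun n ↦ ‖b n‖)
    (hmult : ∀ a : ℂ, a ≠ 0 → {n : ℕ | b n = a⁻¹}.ncard = analyticOrderNatAt (fun w ↦ xiPairLift χ (w + 9 / 4)) a)
    (S : Finset ℂ) (hS : ∀ ρ ∈ S, dirichletXi χ ρ = 0 ∧ ρ ≠ 1 / 2) :
    ∑ ρ ∈ S, DirichletDisc.zeroOrder χ ρ ≤ (S.biUnion fun ρ => (finite_index hbs ρ).toFinset).card := by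
  classical
  set E : ℂ → Finset ℕ := fun ρ => (finite_index hbs ρ).toFinset with hE
  set U := S.biUnion E with hU
  have hcardE : ∀ ρ ∈ S, (E ρ).card = 2 * DirichletDisc.zeroOrder χ ρ := by
    intro ρ hρ
    have hΞ : xiPair χ ρ = 0 := by rw [xiPair_eq_sq hquad, (hS ρ hρ).1]; simp
    exact card_index_eq_two_mul hχ hquad h1 hbs hmult hΞ (hS ρ hρ).2
  -- double counting with `r ρ k := k ∈ E ρ`
  have hdc := Finset.sum_card_bipartiteAbove_eq_sum_card_bipartiteBelow (r := fun ρ k => k ∈ E ρ) (s := S) (t := U)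
  have habove : ∀ ρ ∈ S, U.bipartiteAbove (fun ρ k => k ∈ E ρ) ρ = E ρ := by
    intro ρ hρ
    ext k
    simp only [Finset.mem_bipartiteAbove, hU, Finset.mem_biUnion]
    exact ⟨fun h => h.2, fun h => ⟨⟨ρ, hρ, h⟩, h⟩⟩
  have hbelow : ∀ k ∈ U, (S.bipartiteBelow (fun ρ k => k ∈ E ρ) k).card ≤ 2 := by
    intro k _
    have hsub : ∀ ρ ∈ S.bipartiteBelow (fun ρ k => k ∈ E ρ) k, ρ = xiPairZero b k ∨ ρ = 1 - xiPairZero b k := by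
      intro ρ hρ
      rw [Finset.mem_bipartiteBelow] at hρ
      obtain ⟨-, h | h⟩ := (Set.Finite.mem_toFinset _).1 hρ.2
      · exact Or.inl h.symm
      · exact Or.inr h.symm
    calc (S.bipartiteBelow (fun ρ k => k ∈ E ρ) k).card
        ≤ (Finset.univ : Finset Bool).card :=
          Finset.card_le_card_of_injOn (fun ρ => decide (ρ = xiPairZero b k)) (fun _ _ => Finset.mem_univ _)
            (by
              intro ρ hρ ρ' hρ' h
              simp only at h
              rcases hsub ρ hρ with e | e <;> rcases hsub ρ' hρ' with e' | e'
              · rw [e, e']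
              · rw [e, e'] at h ⊢
                simp at h
                exact h.symm
              · rw [e, e'] at h ⊢
                simp at h
                exact h
              · rw [e, e'])
      _ = 2 := by simp
  have hsum : ∑ ρ ∈ S, (E ρ).card ≤ 2 * U.card := by
    calc ∑ ρ ∈ S, (E ρ).card = ∑ ρ ∈ S, (U.bipartiteAbove (fun ρ k => k ∈ E ρ) ρ).card :=
          Finset.sum_congr rfl fun ρ hρ => by rw [habove ρ hρ]
      _ = ∑ k ∈ U, (S.bipartiteBelow (fun ρ k => k ∈ E ρ) k).card := hdc
      _ ≤ ∑ k ∈ U, 2 := Finset.sum_le_sum hbelow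
      _ = 2 * U.card := by rw [Finset.sum_const, smul_eq_mul, mul_comm]
  rw [Finset.sum_congr rfl hcardE, ← Finset.mul_sum] at hsum
  omega

/-- **Theorem 7 (iv), general `m`:** if `h₂(δ, m) + C(𝒵, δ) = (m/2) φ(½, 0, δ) + C(𝒵, δ) > w_{1,δ}`, then the zero of
`L(s, χ)` at the central point has multiplicity `< m`. [cite: HiaryIrelandKyi2026, §4 Theorem 7 (iv)] -/
theorem zeroOrder_half_lt (hχ : χ.IsPrimitive) (hquad : χ.IsQuadratic) (h1 : χ ≠ 1) {δ : ℝ} (hδ : δ ≤ 0)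
    {τ : ℝ} {Z : Finset (ℝ × ℝ)} (hZ : IsSignChangeData χ τ Z) {m : ℕ}
    (hineq : wOne χ δ < m / 2 * phi (1 / 2) 0 δ + C Z δ) :
    DirichletDisc.zeroOrder χ (1 / 2) < m := by
  obtain ⟨b, hbs, -, hmult, hprod⟩ := exists_xiPair_hadamardSeq hχ h1
  obtain ⟨U, hU, hUsum⟩ := exists_knownZeros hχ hquad h1 hδ hZ hbs hmult hprod
  have bound : ∀ E : Finset ℕ, Disjoint E U →
      (∑ k ∈ E, (-(2 * b k * ((((1 - δ : ℝ)) : ℂ) - 1 / 2)) /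
        (1 - b k * (((((1 - δ : ℝ)) : ℂ) - 1 / 2) ^ 2 - 9 / 4))).re) + 2 * C Z δ ≤ 2 * wOne χ δ := by
    intro E hE
    have h := sum_re_term_le_two_mul_wOne hχ hquad h1 hδ hbs hprod (E ∪ U)
    rw [Finset.sum_union hE] at h
    linarith
  have hφ0 : 0 ≤ phi (1 / 2) 0 δ := phi_nonneg (by norm_num) (by norm_num) hδ
  by_contra hm
  rw [not_lt] at hm
  by_cases hL : χ.LFunction (1 / 2) = 0
  · have hξ : dirichletXi χ (1 / 2) = 0 :=
      (dirichletXi_eq_zero_iff_mem_charNontrivialZeros hχ h1 _).2 ⟨hL, by norm_num, by norm_num⟩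
    obtain ⟨hs, -, -⟩ := sum_index_eq hχ hquad h1 hδ hbs hmult hprod hξ
    have hc := card_index_half_eq hχ hquad h1 hbs hmult (by rw [xiPair_eq_sq hquad, hξ]; simp)
    have hdU : Disjoint (finite_index hbs (1 / 2 : ℂ)).toFinset U := by
      rw [Finset.disjoint_left]
      intro k hk hkU
      obtain ⟨-, -, him⟩ := hU k hkU
      obtain ⟨-, h | h⟩ := (Set.Finite.mem_toFinset _).1 hk
      · exact him (by rw [h]; simp)
      · exact him (by rw [show xiPairZero b k = 1 - 1 / 2 by rw [← h]; ring]; simp)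
    have hb := bound _ hdU
    rw [hs, hc] at hb
    have hre : ((1 / 2 : ℂ)).re = 1 / 2 := by simp
    have him : ((1 / 2 : ℂ)).im = 0 := by simp
    rw [hre, him] at hb
    have hm' : (m : ℝ) ≤ DirichletDisc.zeroOrder χ (1 / 2) := by exact_mod_cast hm
    nlinarith
  · have h0 : DirichletDisc.zeroOrder χ (1 / 2) = 0 := by
      by_contra hne
      exact hL ((DirichletDisc.zeroOrder_pos_iff χ h1 _).1 (Nat.pos_of_ne_zero hne))
    rw [h0] at hm
    have hm0 : (m : ℝ) = 0 := by exact_mod_cast Nat.le_zero.mp hm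
    have hb := bound ∅ (Finset.disjoint_empty_left _)
    rw [Finset.sum_empty] at hb
    rw [hm0] at hineq
    linarith

/-- **Theorem 7 (iii), general `m`:** if `h₁(δ, m) + C(𝒵, δ) = m φ(½, 0, δ) + C(𝒵, δ) > w_{1,δ}`, then `L(s, χ)` has fewer
than `2m` real zeros off the critical line, counted with multiplicity: for every finite set `S ⊆ (0, 1) ∖ {½}`,
`Σ_{β ∈ S} m_χ(β) < 2m`. [cite: HiaryIrelandKyi2026, §4 Theorem 7 (iii)] -/
theorem sum_zeroOrder_real_lt (hχ : χ.IsPrimitive) (hquad : χ.IsQuadratic) (h1 : χ ≠ 1) {δ : ℝ} (hδ : δ ≤ 0)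
    {τ : ℝ} {Z : Finset (ℝ × ℝ)} (hZ : IsSignChangeData χ τ Z) {m : ℕ}
    (hineq : wOne χ δ < m * phi (1 / 2) 0 δ + C Z δ) (S : Finset ℝ)
    (hS : ∀ β ∈ S, 0 < β ∧ β < 1 ∧ β ≠ 1 / 2) :
    ∑ β ∈ S, DirichletDisc.zeroOrder χ β < 2 * m := by
  classical
  obtain ⟨b, hbs, -, hmult, hprod⟩ := exists_xiPair_hadamardSeq hχ h1
  obtain ⟨U, hU, hUsum⟩ := exists_knownZeros hχ hquad h1 hδ hZ hbs hmult hprod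
  have h2 := xiPair_two_ne_zero hχ h1
  have hΞ0 : xiPair χ (((1 - δ : ℝ)) : ℂ) ≠ 0 := by
    rw [xiPair_eq_sq hquad]; exact pow_ne_zero 2 (dirichletXi_ne_zero_one_sub hχ h1 hδ)
  have bound : ∀ E : Finset ℕ, Disjoint E U →
      (∑ k ∈ E, (-(2 * b k * ((((1 - δ : ℝ)) : ℂ) - 1 / 2)) /
        (1 - b k * (((((1 - δ : ℝ)) : ℂ) - 1 / 2) ^ 2 - 9 / 4))).re) + 2 * C Z δ ≤ 2 * wOne χ δ := by
    intro E hE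
    have h := sum_re_term_le_two_mul_wOne hχ hquad h1 hδ hbs hprod (E ∪ U)
    rw [Finset.sum_union hE] at h
    linarith
  -- restrict to the zeros and pass to complex points
  set S' : Finset ℝ := S.filter fun β : ℝ => χ.LFunction (β : ℂ) = 0 with hS'
  set SC : Finset ℂ := S'.image fun β : ℝ => (β : ℂ) with hSC
  have hSCz : ∀ ρ ∈ SC, dirichletXi χ ρ = 0 ∧ ρ ≠ 1 / 2 := by
    intro ρ hρ
    obtain ⟨β, hβ, rfl⟩ := Finset.mem_image.1 hρ
    obtain ⟨hβS, hL⟩ := Finset.mem_filter.1 hβ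
    obtain ⟨h0, h1', hne⟩ := hS β hβS
    refine ⟨(dirichletXi_eq_zero_iff_mem_charNontrivialZeros hχ h1 _).2 ⟨hL, by simpa using h0, by simpa using h1'⟩,
      fun h => hne ?_⟩
    have h' := congrArg Complex.re h
    norm_num at h'
    exact h'
  set V := SC.biUnion fun ρ => (finite_index hbs ρ).toFinset with hV
  have hcount := sum_zeroOrder_le_card_biUnion hχ hquad h1 hbs hmult SC hSCz
  -- every index of `V` has value `≥ φ(½, 0, δ)` and real part off the centre
  have hval : ∀ k ∈ V, phi (1 / 2) 0 δ ≤ (-(2 * b k * ((((1 - δ : ℝ)) : ℂ) - 1 / 2)) /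
        (1 - b k * (((((1 - δ : ℝ)) : ℂ) - 1 / 2) ^ 2 - 9 / 4))).re ∧ (xiPairZero b k).re ≠ 1 / 2 := by
    intro k hk
    obtain ⟨ρ, hρ, hk'⟩ := Finset.mem_biUnion.1 hk
    obtain ⟨β, hβ, rfl⟩ := Finset.mem_image.1 hρ
    obtain ⟨hβS, -⟩ := Finset.mem_filter.1 hβ
    obtain ⟨h0, h1', hne⟩ := hS β hβS
    obtain ⟨hb, hk''⟩ := (Set.Finite.mem_toFinset _).1 hk'
    refine ⟨?_, ?_⟩
    · rw [re_term_eq_phi hb (factor_ne_zero_of_xiPair_ne_zero h2 hprod hΞ0 k) hk'', Complex.ofReal_re,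
        Complex.ofReal_im]
      exact phi_half_zero_le h0 h1' hδ
    · rcases hk'' with h | h
      · rw [h, Complex.ofReal_re]; exact hne
      · rw [show xiPairZero b k = 1 - (β : ℂ) by rw [← h]; ring, Complex.sub_re, Complex.one_re, Complex.ofReal_re]
        intro h'; exact hne (by linarith)
  have hdU : Disjoint V U := by
    rw [Finset.disjoint_left]
    intro k hk hkU
    exact (hval k hk).2 (hU k hkU).2.1
  have hb := bound V hdU
  have hVsum : (V.card : ℝ) * phi (1 / 2) 0 δ ≤ ∑ k ∈ V, (-(2 * b k * ((((1 - δ : ℝ)) : ℂ) - 1 / 2)) /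
        (1 - b k * (((((1 - δ : ℝ)) : ℂ) - 1 / 2) ^ 2 - 9 / 4))).re := by
    have := Finset.card_nsmul_le_sum V (fun k => (-(2 * b k * ((((1 - δ : ℝ)) : ℂ) - 1 / 2)) /
        (1 - b k * (((((1 - δ : ℝ)) : ℂ) - 1 / 2) ^ 2 - 9 / 4))).re) _ fun k hk => (hval k hk).1
    rwa [nsmul_eq_mul] at this
  -- the sum over `S` equals the sum over the zeros, and `Σ_{SC} = Σ_{S'}`
  have hS_eq : ∑ β ∈ S, DirichletDisc.zeroOrder χ (β : ℂ) = ∑ β ∈ S', DirichletDisc.zeroOrder χ (β : ℂ) := by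
    rw [hS']
    exact (Finset.sum_filter_of_ne fun β _ hne =>
      (DirichletDisc.zeroOrder_pos_iff χ h1 _).1 (Nat.pos_of_ne_zero hne)).symm
  have hSC_eq : ∑ ρ ∈ SC, DirichletDisc.zeroOrder χ ρ = ∑ β ∈ S', DirichletDisc.zeroOrder χ (β : ℂ) := by
    rw [hSC, Finset.sum_image]
    intro x _ y _ h
    have h' : (x : ℂ) = (y : ℂ) := h
    exact_mod_cast h'
  by_contra hlt
  rw [not_lt, hS_eq, ← hSC_eq] at hlt
  have hVc : 2 * m ≤ V.card := hlt.trans hcount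
  have hVc' : (2 * m : ℝ) ≤ V.card := by exact_mod_cast hVc
  have hφ0 : 0 ≤ phi (1 / 2) 0 δ := phi_nonneg (by norm_num) (by norm_num) hδ
  nlinarith

/-- **Theorem 7 (i), general `m`:** if `f₁(η, δ, m) + C(𝒵, δ) = 2m·min(φ(0,η,δ), φ(½,η,δ)) + C(𝒵, δ) > w_{1,δ}`, then
`L(s, χ)` has fewer than `4m` non-real zeros off the critical line of height `≤ η`, counted with multiplicity: for every
finite set `S` of such zeros, `Σ_{ρ ∈ S} m_χ(ρ) < 4m`. [cite: HiaryIrelandKyi2026, §4 Theorem 7 (i)] -/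
theorem sum_zeroOrder_offLine_lt (hχ : χ.IsPrimitive) (hquad : χ.IsQuadratic) (h1 : χ ≠ 1) {δ : ℝ} (hδ : δ ≤ 0)
    {τ : ℝ} {Z : Finset (ℝ × ℝ)} (hZ : IsSignChangeData χ τ Z) {m : ℕ} {η : ℝ} (hη : 0 < η)
    (hineq : wOne χ δ < 2 * m * min (phi 0 η δ) (phi (1 / 2) η δ) + C Z δ) (S : Finset ℂ)
    (hS : ∀ ρ ∈ S, χ.LFunction ρ = 0 ∧ 0 < ρ.re ∧ ρ.re < 1 ∧ ρ.re ≠ 1 / 2 ∧ ρ.im ≠ 0 ∧ |ρ.im| ≤ η) :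
    ∑ ρ ∈ S, DirichletDisc.zeroOrder χ ρ < 4 * m := by
  classical
  obtain ⟨b, hbs, -, hmult, hprod⟩ := exists_xiPair_hadamardSeq hχ h1
  obtain ⟨U, hU, hUsum⟩ := exists_knownZeros hχ hquad h1 hδ hZ hbs hmult hprod
  have h2 := xiPair_two_ne_zero hχ h1
  have hΞ0 : xiPair χ (((1 - δ : ℝ)) : ℂ) ≠ 0 := by
    rw [xiPair_eq_sq hquad]; exact pow_ne_zero 2 (dirichletXi_ne_zero_one_sub hχ h1 hδ)
  have bound : ∀ E : Finset ℕ, Disjoint E U →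
      (∑ k ∈ E, (-(2 * b k * ((((1 - δ : ℝ)) : ℂ) - 1 / 2)) /
        (1 - b k * (((((1 - δ : ℝ)) : ℂ) - 1 / 2) ^ 2 - 9 / 4))).re) + 2 * C Z δ ≤ 2 * wOne χ δ := by
    intro E hE
    have h := sum_re_term_le_two_mul_wOne hχ hquad h1 hδ hbs hprod (E ∪ U)
    rw [Finset.sum_union hE] at h
    linarith
  have hSC : ∀ ρ ∈ S, dirichletXi χ ρ = 0 ∧ ρ ≠ 1 / 2 := by
    intro ρ hρ
    obtain ⟨hL, h0, h1', hne, -, -⟩ := hS ρ hρ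
    exact ⟨(dirichletXi_eq_zero_iff_mem_charNontrivialZeros hχ h1 _).2 ⟨hL, h0, h1'⟩,
      fun h => hne (by rw [h]; simp)⟩
  set V := S.biUnion fun ρ => (finite_index hbs ρ).toFinset with hV
  have hcount := sum_zeroOrder_le_card_biUnion hχ hquad h1 hbs hmult S hSC
  set μ := min (phi 0 η δ) (phi (1 / 2) η δ) with hμ
  have hval : ∀ k ∈ V, μ ≤ (-(2 * b k * ((((1 - δ : ℝ)) : ℂ) - 1 / 2)) /
        (1 - b k * (((((1 - δ : ℝ)) : ℂ) - 1 / 2) ^ 2 - 9 / 4))).re ∧ (xiPairZero b k).re ≠ 1 / 2 := by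
    intro k hk
    obtain ⟨ρ, hρ, hk'⟩ := Finset.mem_biUnion.1 hk
    obtain ⟨-, h0, h1', hne, him, hη'⟩ := hS ρ hρ
    obtain ⟨hb, hk''⟩ := (Set.Finite.mem_toFinset _).1 hk'
    refine ⟨?_, ?_⟩
    · rw [re_term_eq_phi hb (factor_ne_zero_of_xiPair_ne_zero h2 hprod hΞ0 k) hk'']
      have hmono : phi ρ.re η δ ≤ phi ρ.re ρ.im δ :=
        phi_le_phi_of_sq_le h0.le h1'.le hδ him (by nlinarith [abs_le.mp hη', sq_abs ρ.im])
      exact (min_phi_le (η := η) h0.le h1'.le hδ hη).trans hmono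
    · rcases hk'' with h | h
      · rw [h]; exact hne
      · rw [show xiPairZero b k = 1 - ρ by rw [← h]; ring, Complex.sub_re, Complex.one_re]
        intro h'; exact hne (by linarith)
  have hdU : Disjoint V U := by
    rw [Finset.disjoint_left]
    intro k hk hkU
    exact (hval k hk).2 (hU k hkU).2.1
  have hb := bound V hdU
  have hVsum : (V.card : ℝ) * μ ≤ ∑ k ∈ V, (-(2 * b k * ((((1 - δ : ℝ)) : ℂ) - 1 / 2)) /
        (1 - b k * (((((1 - δ : ℝ)) : ℂ) - 1 / 2) ^ 2 - 9 / 4))).re := by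
    have := Finset.card_nsmul_le_sum V (fun k => (-(2 * b k * ((((1 - δ : ℝ)) : ℂ) - 1 / 2)) /
        (1 - b k * (((((1 - δ : ℝ)) : ℂ) - 1 / 2) ^ 2 - 9 / 4))).re) _ fun k hk => (hval k hk).1
    rwa [nsmul_eq_mul] at this
  by_contra hlt
  rw [not_lt] at hlt
  have hVc : 4 * m ≤ V.card := hlt.trans hcount
  have hVc' : (4 * m : ℝ) ≤ V.card := by exact_mod_cast hVc
  have hμ0 : 0 ≤ μ := le_min (phi_nonneg le_rfl zero_le_one hδ) (phi_nonneg (by norm_num) (by norm_num) hδ)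
  nlinarith

end GeneralMultiplicity

end HiaryIrelandKyi2026

/-! ### The discharge -/

open DirichletTheta HiaryIrelandKyi2026 in
/-- **Hiary–Ireland–Kyi 2026, Theorem 7 (i), (iii), (iv) (`m = 1`) for primitive quadratic `χ` — PROVED.**
[cite: HiaryIrelandKyi2026, §4 Theorem 7 (i), (iii), (iv), with Lemma 4, Corollary 5 and Lemma 6] -/
theorem hiaryIrelandKyi2026_theorem7_holds : hiaryIrelandKyi2026_theorem7 := by
  intro q _ χ hχ hquad h1 δ hδ τ hτ Z hZ
  obtain ⟨b, hbs, -, hmult, hprod⟩ := exists_xiPair_hadamardSeq hχ h1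
  obtain ⟨U, hU, hUsum⟩ := exists_knownZeros hχ hquad h1 hδ hZ hbs hmult hprod
  -- the master inequality: an extra block `E` disjoint from the known zeros
  have bound : ∀ E : Finset ℕ, Disjoint E U →
      (∑ k ∈ E, (-(2 * b k * ((((1 - δ : ℝ)) : ℂ) - 1 / 2)) /
        (1 - b k * (((((1 - δ : ℝ)) : ℂ) - 1 / 2) ^ 2 - 9 / 4))).re) + 2 * C Z δ ≤ 2 * wOne χ δ := by
    intro E hE
    have h := sum_re_term_le_two_mul_wOne hχ hquad h1 hδ hbs hprod (E ∪ U)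
    rw [Finset.sum_union hE] at h
    linarith
  have hmemE : ∀ (ρ : ℂ) (k : ℕ), k ∈ (finite_index hbs ρ).toFinset →
      xiPairZero b k = ρ ∨ xiPairZero b k = 1 - ρ := by
    intro ρ k hk
    obtain ⟨-, h | h⟩ := (Set.Finite.mem_toFinset _).1 hk
    · exact Or.inl h
    · exact Or.inr (by rw [← h]; ring)
  -- a block through a point off the critical line is disjoint from `U`
  have hdisjU : ∀ ρ : ℂ, ρ.re ≠ 1 / 2 → Disjoint (finite_index hbs ρ).toFinset U := by
    intro ρ hρ
    rw [Finset.disjoint_left]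
    intro k hk hkU
    obtain ⟨-, hre, -⟩ := hU k hkU
    rcases hmemE ρ k hk with h | h
    · exact hρ (by rw [← h, hre])
    · apply hρ
      have := congrArg Complex.re h
      rw [hre, Complex.sub_re, Complex.one_re] at this
      linarith
  have hξ_of : ∀ ρ : ℂ, χ.LFunction ρ = 0 → 0 < ρ.re → ρ.re < 1 → dirichletXi χ ρ = 0 := fun ρ hL h0 h1' =>
    (dirichletXi_eq_zero_iff_mem_charNontrivialZeros hχ h1 ρ).2 ⟨hL, h0, h1'⟩
  refine ⟨?_, ?_, ?_⟩
  · -- (i): a non-real zero off the line of height `≤ η` and its three symmetric images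
    intro η hη hineq ρ hL hre0 hre1 him hη'
    by_contra hβ
    have hξ := hξ_of ρ hL hre0 hre1
    -- the conjugate zero
    have hξ' : dirichletXi χ (conj ρ) = 0 := by
      have h : xiPair χ (conj ρ) = 0 := by
        rw [← conj_xiPair h1, xiPair_eq_sq hquad, hξ]; simp
      rw [xiPair_eq_sq hquad] at h
      exact pow_eq_zero_iff (n := 2) two_ne_zero |>.1 h
    obtain ⟨hs1, hc1, -⟩ := sum_index_eq hχ hquad h1 hδ hbs hmult hprod hξ
    obtain ⟨hs2, hc2, -⟩ := sum_index_eq hχ hquad h1 hδ hbs hmult hprod hξ'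
    set E₁ := (finite_index hbs ρ).toFinset with hE₁
    set E₂ := (finite_index hbs (conj ρ)).toFinset with hE₂
    have hne1 : ρ ≠ 1 / 2 := fun h => him (by rw [h]; simp)
    have hne2 : conj ρ ≠ 1 / 2 := fun h => him (by have := congrArg Complex.im h; simpa using this)
    have h12 : Disjoint E₁ E₂ := by
      rw [Finset.disjoint_left]
      intro k hk1 hk2
      rcases hmemE ρ k hk1 with h | h <;> rcases hmemE (conj ρ) k hk2 with h' | h'
      · exact him (by have := congrArg Complex.im (h.symm.trans h'); simp at this; linarith)
      · exact hβ (by have := congrArg Complex.re (h.symm.trans h'); simp at this; linarith)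
      · exact hβ (by have := congrArg Complex.re (h.symm.trans h'); simp at this; linarith)
      · exact him (by have := congrArg Complex.im (h.symm.trans h'); simp at this; linarith)
    have hdU : Disjoint (E₁ ∪ E₂) U := by
      rw [Finset.disjoint_union_left]
      exact ⟨hdisjU ρ hβ, hdisjU (conj ρ) (by simpa using hβ)⟩
    have hb := bound (E₁ ∪ E₂) hdU
    rw [Finset.sum_union h12, hs1, hs2] at hb
    have hc1' : (2 : ℝ) ≤ E₁.card := by exact_mod_cast hc1 hne1
    have hc2' : (2 : ℝ) ≤ E₂.card := by exact_mod_cast hc2 hne2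
    -- `φ(β, ±γ, δ) ≥ φ(β, η, δ) ≥ min(φ(0,η,δ), φ(½,η,δ))`
    have hφ' : phi (conj ρ).re (conj ρ).im δ = phi ρ.re ρ.im δ := by
      rw [Complex.conj_re, Complex.conj_im, phi_neg_eta]
    rw [hφ'] at hb
    have hφ0 : 0 ≤ phi ρ.re ρ.im δ := phi_nonneg hre0.le hre1.le hδ
    have hmono : phi ρ.re η δ ≤ phi ρ.re ρ.im δ :=
      phi_le_phi_of_sq_le hre0.le hre1.le hδ him (by nlinarith [abs_le.mp hη', sq_abs ρ.im])
    have hmin := min_phi_le (η := η) hre0.le hre1.le hδ hη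
    nlinarith
  · -- (iii): a real zero `β ≠ ½` and its partner `1 − β`
    intro hineq β hβ0 hβ1 hβne hL
    have hξ := hξ_of β hL (by simpa using hβ0) (by simpa using hβ1)
    obtain ⟨hs, hc, -⟩ := sum_index_eq hχ hquad h1 hδ hbs hmult hprod hξ
    have hne : (β : ℂ) ≠ 1 / 2 := fun h => hβne (by
      have h' := congrArg Complex.re h
      norm_num at h'
      exact h')
    have hdU : Disjoint (finite_index hbs (β : ℂ)).toFinset U := hdisjU β (by simpa using hβne)
    have hb := bound _ hdU
    rw [hs, Complex.ofReal_re, Complex.ofReal_im] at hb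
    have hc' : (2 : ℝ) ≤ (finite_index hbs (β : ℂ)).toFinset.card := by exact_mod_cast hc hne
    have hφ : phi (1 / 2) 0 δ ≤ phi β 0 δ := phi_half_zero_le hβ0 hβ1 hδ
    have hφ0 : 0 ≤ phi β 0 δ := phi_nonneg hβ0.le hβ1.le hδ
    nlinarith
  · -- (iv): a zero at the central point
    intro hineq hL
    have hξ := hξ_of (1 / 2) hL (by norm_num) (by norm_num)
    obtain ⟨hs, -, hc⟩ := sum_index_eq hχ hquad h1 hδ hbs hmult hprod hξ
    have hdU : Disjoint (finite_index hbs (1 / 2 : ℂ)).toFinset U := by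
      rw [Finset.disjoint_left]
      intro k hk hkU
      obtain ⟨-, -, him⟩ := hU k hkU
      rcases hmemE (1 / 2) k hk with h | h
      · exact him (by rw [h]; simp)
      · exact him (by rw [h]; simp)
    have hb := bound _ hdU
    rw [hs] at hb
    have hre : ((1 / 2 : ℂ)).re = 1 / 2 := by simp
    have him : ((1 / 2 : ℂ)).im = 0 := by simp
    rw [hre, him] at hb
    have hc' : (1 : ℝ) ≤ (finite_index hbs (1 / 2 : ℂ)).toFinset.card := by exact_mod_cast hc rfl
    have hφ0 : 0 ≤ phi (1 / 2) 0 δ := phi_nonneg (by norm_num) (by norm_num) hδ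
    nlinarith

open DirichletTheta HiaryIrelandKyi2026 in
/-- **Hiary–Ireland–Kyi 2026, Corollary 1 (intervals `[γ₋, γ₊] ⊆ [0, τ]`) — PROVED:** Theorem 7 (i) at `δ = −1`, `m = 1`
for the even primitive quadratic character `χ_d` (`f₁(η, −1, 1) = 2ι(η)`, `C(𝒵, −1) = Σ 12/(9 + 4γ₊²)`,
`w_{1,−1} = ½ log(d/(πe^γ)) + (L'/L)(2, χ_d)` — `HiaryIrelandKyi2026.corollary1_ineq_iff`), the odd-multiplicity zeros of
the hypothesis supplying the known zeros directly (`t > 0` because `ord_{½} L(s, χ_d)` is even).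
[cite: HiaryIrelandKyi2026, §1 Corollary 1; §4 Theorem 7 (i), Corollary 5] -/
theorem hiaryIrelandKyi2026_corollary1_holds : hiaryIrelandKyi2026_corollary1 := by
  intro q _ χ hχ hquad heven h1 τ hτ Z hZ η hη hineq ρ hL hre0 hre1 him0 himη
  rw [← HiaryIrelandKyi2026.corollary1_ineq_iff heven Z η] at hineq
  obtain ⟨b, hbs, -, hmult, hprod⟩ := exists_xiPair_hadamardSeq hχ h1
  have hδ : (-1 : ℝ) ≤ 0 := by norm_num
  obtain ⟨U, hU, hUsum⟩ := exists_knownZeros_of_zeros hχ hquad h1 hδ hZ.2.1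
    (zeros_of_isOddZeroData hχ hquad h1 hZ) hbs hmult hprod
  exact noOffLine_of_knownZeros hχ hquad h1 hδ hbs hmult hprod hU hUsum hη hineq hL hre0 hre1 him0.ne'
    (by rw [abs_of_pos him0]; exact himη)

open DirichletTheta HiaryIrelandKyi2026 in
/-- **Theorem 7 (iii) + (iv) combined (`m = 1`): a certificate for «no real zero».**  For a primitive quadratic `χ`,
`δ ≤ 0` and sign-change data `𝒵`: if `w_{1,δ} < h₂(δ, 1) + C(𝒵, δ) = 1/(½ − δ) + C(𝒵, δ)`, then `L(σ, χ) ≠ 0` for every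
`σ ∈ (0, 1)` (`h₂ = ½ φ(½, 0, δ) = 1/(½ − δ) ≤ h₁ = 2/(½ − δ)`, so (iii) and (iv) both apply).
[cite: HiaryIrelandKyi2026, §4 Theorem 7 (iii), (iv) (m = 1: «non-vanishing of L(s) on the real line»)] -/
theorem HiaryIrelandKyi2026.LFunction_ne_zero_of_signChangeData {q : ℕ} [NeZero q]
    {χ : DirichletCharacter ℂ q} (hχ : χ.IsPrimitive) (hquad : χ.IsQuadratic) (h1 : χ ≠ 1) {δ : ℝ} (hδ : δ ≤ 0)
    {τ : ℝ} (hτ : 0 < τ) {Z : Finset (ℝ × ℝ)} (hZ : IsSignChangeData χ τ Z)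
    (hw : wOne χ δ < 1 / (1 / 2 - δ) + C Z δ) {σ : ℝ} (h0 : 0 < σ) (h1σ : σ < 1) :
    χ.LFunction σ ≠ 0 := by
  obtain ⟨-, hiii, hiv⟩ := hiaryIrelandKyi2026_theorem7_holds q χ hχ hquad h1 δ hδ τ hτ Z hZ
  have hδ' : δ < 1 / 2 := by linarith
  have hφ : phi (1 / 2) 0 δ = 2 / (1 / 2 - δ) := phi_half_zero hδ'
  have hpos : 0 < 1 / (1 / 2 - δ) := by apply div_pos one_pos; linarith
  have e1 : 1 / 2 * (2 / (1 / 2 - δ)) = 1 / (1 / 2 - δ) := by ring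
  have e2 : 2 / (1 / 2 - δ) = 2 * (1 / (1 / 2 - δ)) := by ring
  by_cases hσ : σ = 1 / 2
  · subst hσ
    have h := hiv (by rw [hφ, e1]; exact hw)
    push_cast
    exact h
  · exact hiii (by rw [hφ, e2]; linarith) σ h0 h1σ hσ

open DirichletTheta HiaryIrelandKyi2026 in
/-- **The same with no known zeros (`𝒵 = ∅`):** `w_{1,δ} < 1/(½ − δ)` for some `δ ≤ 0` already excludes every real zero of
`L(s, χ)` in `(0, 1)`. [cite: HiaryIrelandKyi2026, §4 Theorem 7 (iii), (iv)] -/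
theorem HiaryIrelandKyi2026.LFunction_ne_zero_of_wOne_lt {q : ℕ} [NeZero q]
    {χ : DirichletCharacter ℂ q} (hχ : χ.IsPrimitive) (hquad : χ.IsQuadratic) (h1 : χ ≠ 1) {δ : ℝ} (hδ : δ ≤ 0)
    (hw : wOne χ δ < 1 / (1 / 2 - δ)) {σ : ℝ} (h0 : 0 < σ) (h1σ : σ < 1) :
    χ.LFunction σ ≠ 0 := by
  have hZ : IsSignChangeData χ 1 ∅ := ⟨by simp, by simp, by simp⟩
  refine LFunction_ne_zero_of_signChangeData hχ hquad h1 hδ one_pos hZ ?_ h0 h1σ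
  rw [C, Finset.sum_empty, add_zero]
  exact hw

open DirichletTheta HiaryIrelandKyi2026 in
/-- **Riemann's method as a lineage for the wide criterion `NoRealZeroUpTo Q`** (the cell's certified-table predicate,
`NoRealZeroUpTo.lean`): if for every primitive quadratic `χ` mod `3 ≤ q ≤ Q` one has Theorem-7 data — a shift `δ ≤ 0`,
sign-change intervals `𝒵 ⊆ [0, τ]` for `ξ(½ + it, χ)`, and the inequality `w_{1,δ} < 1/(½ − δ) + C(𝒵, δ)` — then no
`L(s, χ)` in the table has a real zero in `(0, 1)`.  (A conditional bridge: the sign-change witnesses and the value of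
`w_{1,δ}` are certified numerically, outside the kernel.) [cite: HiaryIrelandKyi2026, §4 Theorem 7 (iii), (iv); §1
(«a method for verifying the generalized Riemann hypothesis»)] -/
theorem NoRealZeroUpTo.of_riemannMethod {Q : ℕ}
    (h : ∀ (q : ℕ) [NeZero q], 3 ≤ q → q ≤ Q → ∀ χ : DirichletCharacter ℂ q, χ.IsQuadratic → χ.IsPrimitive →
      ∃ δ : ℝ, δ ≤ 0 ∧ ∃ τ : ℝ, 0 < τ ∧ ∃ Z : Finset (ℝ × ℝ),
        IsSignChangeData χ τ Z ∧ wOne χ δ < 1 / (1 / 2 - δ) + C Z δ) :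
    NoRealZeroUpTo Q := by
  intro q _ hq3 hqQ χ hquad hprim σ h0 h1σ
  obtain ⟨δ, hδ, τ, hτ, Z, hZ, hw⟩ := h q hq3 hqQ χ hquad hprim
  have h1 : χ ≠ 1 := by
    intro hχ1
    have hc : χ.conductor = q := hprim
    rw [hχ1, DirichletCharacter.conductor_one] at hc
    omega
  exact LFunction_ne_zero_of_signChangeData hprim hquad h1 hδ hτ hZ hw h0 h1σ

open DirichletTheta HiaryIrelandKyi2026 in
/-- **Riemann's method as a lineage for `LFunctionRHUpTo χ η`** (the tree's «RH for `L(s, χ)` up to height `η`»,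
`DirichletLRiemannHypothesisUpTo.lean`, there fed by Platt 2016 Thm 7.1): for a primitive quadratic `χ`, Theorem-7 data
(`δ ≤ 0`, sign-change intervals `𝒵`) with `w_{1,δ} < min(f₁(η, δ, 1), h₁(δ, 1)) + C(𝒵, δ)` give every zero with
`0 < Re ρ < 1`, `|Im ρ| ≤ η` on the critical line — the non-real ones by (i), the real ones `≠ ½` by (iii).
[cite: HiaryIrelandKyi2026, §4 Theorem 7 (i), (iii); §1 («RH holds for all the nontrivial zeros … with positive height ≤ η»)] -/
theorem LFunctionRHUpTo.of_riemannMethod {q : ℕ} [NeZero q] {χ : DirichletCharacter ℂ q}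
    (hχ : χ.IsPrimitive) (hquad : χ.IsQuadratic) (h1 : χ ≠ 1) {δ : ℝ} (hδ : δ ≤ 0) {τ : ℝ} (hτ : 0 < τ)
    {Z : Finset (ℝ × ℝ)} (hZ : IsSignChangeData χ τ Z) {η : ℝ} (hη : 0 < η)
    (hw : wOne χ δ < min (2 * min (phi 0 η δ) (phi (1 / 2) η δ)) (phi (1 / 2) 0 δ) + C Z δ) :
    LFunctionRHUpTo χ η := by
  obtain ⟨hi, hiii, -⟩ := hiaryIrelandKyi2026_theorem7_holds q χ hχ hquad h1 δ hδ τ hτ Z hZ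
  intro s hL h0 h1' hη'
  by_cases him : s.im = 0
  · by_contra hre
    have hs : s = ((s.re : ℝ) : ℂ) := Complex.ext (by simp) (by simp [him])
    have h := hiii (lt_of_lt_of_le hw (by gcongr; exact min_le_right _ _)) s.re h0 h1' hre
    rw [← hs] at h
    exact h hL
  · exact hi η hη (lt_of_lt_of_le hw (by gcongr; exact min_le_left _ _)) s hL h0 h1' him hη'

namespace HiaryIrelandKyi2026

/-! ### Theorem 7 (v): completeness of the list of zeros -/

section Completeness

open DirichletTheta

variable {q : ℕ} [NeZero q] {χ : DirichletCharacter ℂ q} {b : ℕ → ℂ}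

/-- The known-zeros block with the location of its indices: every index of `U` sits over one of the chosen zeros
(`|Im ρₖ| ∈ [γ₋, γ₊]` for some interval of `𝒵`). [cite: HiaryIrelandKyi2026, §4 (proof of Theorem 7)] -/
theorem exists_knownZeros_of_zeros' (hχ : χ.IsPrimitive) (hquad : χ.IsQuadratic) (h1 : χ ≠ 1) {δ : ℝ} (hδ : δ ≤ 0)
    {Z : Finset (ℝ × ℝ)} (hZ2 : ∀ P ∈ Z, ∀ Q ∈ Z, P ≠ Q → Disjoint (Set.Icc P.1 P.2) (Set.Icc Q.1 Q.2))
    (key : ∀ P ∈ Z, ∃ t ∈ Set.Icc P.1 P.2, 0 < t ∧ dirichletXi χ (1 / 2 + t * I) = 0)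
    (hbs : Summable fun n ↦ ‖b n‖)
    (hmult : ∀ a : ℂ, a ≠ 0 → {n : ℕ | b n = a⁻¹}.ncard = analyticOrderNatAt (fun w ↦ xiPairLift χ (w + 9 / 4)) a)
    (hprod : ∀ z : ℂ, HasProd (fun n ↦ 1 - b n * (z ^ 2 - 9 / 4)) (xiPair χ (1 / 2 + z) / xiPair χ 2)) :
    ∃ U : Finset ℕ, (∀ k ∈ U, b k ≠ 0 ∧ (xiPairZero b k).re = 1 / 2 ∧ (xiPairZero b k).im ≠ 0 ∧
        ∃ P ∈ Z, |(xiPairZero b k).im| ∈ Set.Icc P.1 P.2) ∧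
      2 * C Z δ ≤ ∑ k ∈ U, (-(2 * b k * ((((1 - δ : ℝ)) : ℂ) - 1 / 2)) /
        (1 - b k * (((((1 - δ : ℝ)) : ℂ) - 1 / 2) ^ 2 - 9 / 4))).re := by
  choose! t ht using key
  set F : ℝ × ℝ → Finset ℕ := fun P => (finite_index hbs (1 / 2 + t P * I)).toFinset with hF
  have hFmem : ∀ P k, k ∈ F P ↔
      b k ≠ 0 ∧ (xiPairZero b k = 1 / 2 + t P * I ∨ 1 - xiPairZero b k = 1 / 2 + t P * I) :=
    fun P k => Set.Finite.mem_toFinset _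
  have hblock : ∀ P ∈ Z, (∑ k ∈ F P, (-(2 * b k * ((((1 - δ : ℝ)) : ℂ) - 1 / 2)) /
        (1 - b k * (((((1 - δ : ℝ)) : ℂ) - 1 / 2) ^ 2 - 9 / 4))).re) = (F P).card * phi (1 / 2) (t P) δ ∧ 2 ≤ (F P).card := by
    intro P hP
    obtain ⟨hsum, hcard, -⟩ := sum_index_eq hχ hquad h1 hδ hbs hmult hprod (ht P hP).2.2
    have hne : (1 / 2 + t P * I : ℂ) ≠ 1 / 2 := by
      intro h
      have := congrArg Complex.im h
      simp at this
      exact (ht P hP).2.1.ne' this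
    refine ⟨?_, hcard hne⟩
    rw [hsum]
    congr 1
    congr 1 <;> simp
  have hdisj : (Z : Set (ℝ × ℝ)).PairwiseDisjoint F := by
    intro P hP Q hQ hPQ
    rw [Function.onFun, Finset.disjoint_left]
    intro k hkP hkQ
    obtain ⟨-, hP'⟩ := (hFmem P k).1 hkP
    obtain ⟨-, hQ'⟩ := (hFmem Q k).1 hkQ
    have htP := (ht P hP).2.1
    have htQ := (ht Q hQ).2.1
    have heq : t P = t Q := by
      rcases hP' with h | h <;> rcases hQ' with h' | h'
      · have := congrArg Complex.im (h.symm.trans h'); simpa using this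
      · exfalso
        have := congrArg Complex.im ((congrArg (fun z => 1 - z) h).symm.trans h')
        simp at this; linarith
      · exfalso
        have := congrArg Complex.im ((congrArg (fun z => 1 - z) h').symm.trans h)
        simp at this; linarith
      · have := congrArg Complex.im (h.symm.trans h'); simpa using this
    have hmemP := (ht P hP).1
    have hmemQ := (ht Q hQ).1
    rw [heq] at hmemP
    exact Set.disjoint_left.mp (hZ2 P hP Q hQ hPQ) hmemP hmemQ
  refine ⟨Z.biUnion F, fun k hk => ?_, ?_⟩
  · obtain ⟨P, hP, hkP⟩ := Finset.mem_biUnion.mp hk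
    obtain ⟨hb, hk'⟩ := (hFmem P k).1 hkP
    have htP := (ht P hP).2.1
    have hρk : xiPairZero b k = 1 / 2 + t P * I ∨ xiPairZero b k = 1 - (1 / 2 + t P * I) := by
      rcases hk' with h | h
      · exact Or.inl h
      · exact Or.inr (by rw [← h]; ring)
    have him : |(xiPairZero b k).im| = t P := by
      rcases hρk with h | h
      · rw [h]; simp [abs_of_pos htP]
      · rw [h]; simp [abs_of_pos htP]
    refine ⟨hb, ?_, ?_, P, hP, by rw [him]; exact (ht P hP).1⟩
    · rcases hρk with h | h
      · rw [h]; norm_num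
      · rw [h]; norm_num
    · intro h0
      rw [h0, abs_zero] at him
      exact htP.ne him
  · rw [Finset.sum_biUnion hdisj, C, Finset.mul_sum]
    refine Finset.sum_le_sum fun P hP => ?_
    obtain ⟨hsum, hcard⟩ := hblock P hP
    rw [hsum, phi_half]
    have hc : (2 : ℝ) ≤ (F P).card := by exact_mod_cast hcard
    have htP0 := (ht P hP).2.1
    have htP2 : t P ≤ P.2 := (ht P hP).1.2
    have hnum : 0 ≤ 1 - 2 * δ := by linarith
    have hY : 0 ≤ (1 - 2 * δ) / ((1 / 2 - δ) ^ 2 + t P ^ 2) := div_nonneg hnum (by positivity)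
    have hA : (1 - 2 * δ) / ((1 / 2 - δ) ^ 2 + P.2 ^ 2) ≤ (1 - 2 * δ) / ((1 / 2 - δ) ^ 2 + t P ^ 2) :=
      div_le_div_of_nonneg_left hnum (by positivity) (by nlinarith)
    calc 2 * ((1 - 2 * δ) / ((1 / 2 - δ) ^ 2 + P.2 ^ 2))
        ≤ 2 * ((1 - 2 * δ) / ((1 / 2 - δ) ^ 2 + t P ^ 2)) := by gcongr
      _ ≤ (F P).card * ((1 - 2 * δ) / ((1 / 2 - δ) ^ 2 + t P ^ 2)) := mul_le_mul_of_nonneg_right hc hY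

/-- **Theorem 7 (v) (completeness of the list), with (ii) at `m = 1`:** if
`F(η, δ) + C(𝒵, δ) > w_{1,δ}`, `F = min(2φ(0,η,δ), φ(½,η,δ), ½φ(½,0,δ))`, then every zero `ρ` of `L(s, χ)` with
`0 < Re ρ < 1` and `0 < Im ρ ≤ η` lies on the critical line, is SIMPLE, and its ordinate belongs to an interval of `𝒵` that
contains no other ordinate of a critical zero («the list of zeros in `𝒵` is complete»).
[cite: HiaryIrelandKyi2026, §4 Theorem 7 (v) (and (ii), m = 1)] -/
theorem zeros_complete (hχ : χ.IsPrimitive) (hquad : χ.IsQuadratic) (h1 : χ ≠ 1) {δ : ℝ} (hδ : δ ≤ 0)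
    {τ : ℝ} (hτ : 0 < τ) {Z : Finset (ℝ × ℝ)} (hZ : IsSignChangeData χ τ Z) {η : ℝ} (hη : 0 < η)
    (hw : wOne χ δ < min (min (2 * phi 0 η δ) (phi (1 / 2) η δ)) (1 / 2 * phi (1 / 2) 0 δ) + C Z δ)
    {ρ : ℂ} (hL : χ.LFunction ρ = 0) (hre0 : 0 < ρ.re) (hre1 : ρ.re < 1) (him0 : 0 < ρ.im) (hη' : ρ.im ≤ η) :
    ρ.re = 1 / 2 ∧ DirichletDisc.zeroOrder χ ρ = 1 ∧
      ∃ P ∈ Z, ρ.im ∈ Set.Icc P.1 P.2 ∧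
        ∀ t ∈ Set.Icc P.1 P.2, χ.LFunction (1 / 2 + t * I) = 0 → t = ρ.im := by
  classical
  obtain ⟨hi, -, hiv⟩ := hiaryIrelandKyi2026_theorem7_holds q χ hχ hquad h1 δ hδ τ hτ Z hZ
  -- the three thresholds dominated by `F`
  have hφ0η : 0 ≤ phi 0 η δ := phi_nonneg le_rfl zero_le_one hδ
  have hφhη : 0 ≤ phi (1 / 2) η δ := phi_nonneg (by norm_num) (by norm_num) hδ
  have hF1 : min (min (2 * phi 0 η δ) (phi (1 / 2) η δ)) (1 / 2 * phi (1 / 2) 0 δ) ≤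
      2 * min (phi 0 η δ) (phi (1 / 2) η δ) := by
    rcases min_cases (phi 0 η δ) (phi (1 / 2) η δ) with ⟨h, _⟩ | ⟨h, _⟩ <;> rw [h]
    · exact (min_le_left _ _).trans (min_le_left _ _)
    · exact (min_le_left _ _).trans ((min_le_right _ _).trans (by linarith))
  have hFh : min (min (2 * phi 0 η δ) (phi (1 / 2) η δ)) (1 / 2 * phi (1 / 2) 0 δ) ≤ phi (1 / 2) η δ :=
    (min_le_left _ _).trans (min_le_right _ _)
  have hF4 : min (min (2 * phi 0 η δ) (phi (1 / 2) η δ)) (1 / 2 * phi (1 / 2) 0 δ) ≤ 1 / 2 * phi (1 / 2) 0 δ :=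
    min_le_right _ _
  set Fm := min (min (2 * phi 0 η δ) (phi (1 / 2) η δ)) (1 / 2 * phi (1 / 2) 0 δ) with hFm
  -- on the line, by (i)
  have hline : ρ.re = 1 / 2 := hi η hη (by linarith) ρ hL hre0 hre1 him0.ne' (by rw [abs_of_pos him0]; exact hη')
  -- no central zero, by (iv)
  have hhalf : χ.LFunction (1 / 2) ≠ 0 := hiv (by linarith)
  -- set-up
  obtain ⟨b, hbs, -, hmult, hprod⟩ := exists_xiPair_hadamardSeq hχ h1
  obtain ⟨hZ1, hZ2, hZ3⟩ := hZ
  set γ := ρ.im with hγ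
  have hρ : ρ = 1 / 2 + γ * I := Complex.ext (by simp [hline]) (by simp [hγ])
  have hξ : dirichletXi χ ρ = 0 := (dirichletXi_eq_zero_iff_mem_charNontrivialZeros hχ h1 ρ).2 ⟨hL, hre0, hre1⟩
  have hρne : ρ ≠ 1 / 2 := fun h => him0.ne' (by rw [hγ, h]; simp)
  obtain ⟨hsρ, hcρ, -⟩ := sum_index_eq hχ hquad h1 hδ hbs hmult hprod hξ
  set Eρ := (finite_index hbs ρ).toFinset with hEρ
  have hmemE : ∀ (ρ : ℂ) (k : ℕ), k ∈ (finite_index hbs ρ).toFinset →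
      xiPairZero b k = ρ ∨ xiPairZero b k = 1 - ρ := by
    intro ρ k hk
    obtain ⟨-, h | h⟩ := (Set.Finite.mem_toFinset _).1 hk
    · exact Or.inl h
    · exact Or.inr (by rw [← h]; ring)
  -- the indices of `Eρ` have `|Im| = γ`
  have himE : ∀ k ∈ Eρ, |(xiPairZero b k).im| = γ := by
    intro k hk
    rcases hmemE ρ k hk with h | h
    · rw [h, hγ, abs_of_pos him0]
    · rw [h, Complex.sub_im, Complex.one_im, zero_sub, abs_neg, hγ, abs_of_pos him0]
  have bound : ∀ (U E : Finset ℕ), Disjoint E U →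
      (∑ k ∈ E, (-(2 * b k * ((((1 - δ : ℝ)) : ℂ) - 1 / 2)) /
        (1 - b k * (((((1 - δ : ℝ)) : ℂ) - 1 / 2) ^ 2 - 9 / 4))).re) + (∑ k ∈ U, (-(2 * b k * ((((1 - δ : ℝ)) : ℂ) - 1 / 2)) /
        (1 - b k * (((((1 - δ : ℝ)) : ℂ) - 1 / 2) ^ 2 - 9 / 4))).re) ≤ 2 * wOne χ δ := by
    intro U E hE
    have h := sum_re_term_le_two_mul_wOne hχ hquad h1 hδ hbs hprod (E ∪ U)
    rwa [Finset.sum_union hE] at h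
  have hφγ : phi (1 / 2) η δ ≤ phi (1 / 2) γ δ :=
    phi_le_phi_of_sq_le (by norm_num) (by norm_num) hδ him0.ne' (by nlinarith)
  have hφγ0 : 0 ≤ phi (1 / 2) γ δ := phi_nonneg (by norm_num) (by norm_num) hδ
  have hcρ' : (2 : ℝ) ≤ Eρ.card := by exact_mod_cast hcρ hρne
  have hsρ' : (∑ k ∈ Eρ, (-(2 * b k * ((((1 - δ : ℝ)) : ℂ) - 1 / 2)) /
        (1 - b k * (((((1 - δ : ℝ)) : ℂ) - 1 / 2) ^ 2 - 9 / 4))).re) = Eρ.card * phi (1 / 2) γ δ := by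
    rw [hsρ, hline, hγ]
  -- (a) some interval contains `γ`
  have hexP : ∃ P ∈ Z, γ ∈ Set.Icc P.1 P.2 := by
    by_contra hno
    have hno' : ∀ P ∈ Z, γ ∉ Set.Icc P.1 P.2 := fun P hP h => hno ⟨P, hP, h⟩
    have key : ∀ P ∈ Z, ∃ t ∈ Set.Icc P.1 P.2, 0 < t ∧ dirichletXi χ (1 / 2 + t * I) = 0 :=
      fun P hP => exists_zero_of_signChange hχ hquad h1 (hZ1 P hP).1 (hZ3 P hP)
    obtain ⟨U, hU, hUsum⟩ := exists_knownZeros_of_zeros' hχ hquad h1 hδ hZ2 key hbs hmult hprod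
    have hdis : Disjoint Eρ U := by
      rw [Finset.disjoint_left]
      intro k hk hkU
      obtain ⟨-, -, -, P, hP, hPk⟩ := hU k hkU
      rw [himE k hk] at hPk
      exact hno' P hP hPk
    have hb := bound U Eρ hdis
    rw [hsρ'] at hb
    have e1 : 2 * phi (1 / 2) γ δ ≤ Eρ.card * phi (1 / 2) γ δ := mul_le_mul_of_nonneg_right hcρ' hφγ0
    linarith only [hb, hUsum, e1, hφγ, hFh, hw]
  obtain ⟨P₀, hP₀, hγP₀⟩ := hexP
  -- the truncated data `Z.erase P₀`
  have hZ2' : ∀ P ∈ Z.erase P₀, ∀ Q ∈ Z.erase P₀, P ≠ Q → Disjoint (Set.Icc P.1 P.2) (Set.Icc Q.1 Q.2) :=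
    fun P hP Q hQ hPQ => hZ2 P (Finset.mem_of_mem_erase hP) Q (Finset.mem_of_mem_erase hQ) hPQ
  have key' : ∀ P ∈ Z.erase P₀, ∃ t ∈ Set.Icc P.1 P.2, 0 < t ∧ dirichletXi χ (1 / 2 + t * I) = 0 :=
    fun P hP => exists_zero_of_signChange hχ hquad h1 (hZ1 P (Finset.mem_of_mem_erase hP)).1
      (hZ3 P (Finset.mem_of_mem_erase hP))
  obtain ⟨U', hU', hU'sum⟩ := exists_knownZeros_of_zeros' hχ hquad h1 hδ hZ2' key' hbs hmult hprod
  have hC : C Z δ = C (Z.erase P₀) δ + (1 - 2 * δ) / ((1 / 2 - δ) ^ 2 + P₀.2 ^ 2) := by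
    rw [C, C, ← Finset.sum_erase_add _ _ hP₀]
  -- an index over `P₀` is not in `U'`
  have hnotU' : ∀ k, b k ≠ 0 → |(xiPairZero b k).im| ∈ Set.Icc P₀.1 P₀.2 → k ∉ U' := by
    intro k _ hk hkU
    obtain ⟨-, -, -, P, hP, hPk⟩ := hU' k hkU
    obtain ⟨hPne, hPZ⟩ := Finset.mem_erase.1 hP
    exact Set.disjoint_left.mp (hZ2 P hPZ P₀ hP₀ hPne) hPk hk
  have hdisρ : Disjoint Eρ U' := by
    rw [Finset.disjoint_left]
    intro k hk
    obtain ⟨hb, -⟩ := (Set.Finite.mem_toFinset _).1 hk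
    exact hnotU' k hb (by rw [himE k hk]; exact hγP₀)
  have hcP₀ : (1 - 2 * δ) / ((1 / 2 - δ) ^ 2 + P₀.2 ^ 2) ≤ phi (1 / 2) γ δ := by
    rw [phi_half]
    exact div_le_div_of_nonneg_left (by linarith) (by positivity) (by nlinarith [hγP₀.1, hγP₀.2, (hZ1 P₀ hP₀).1])
  refine ⟨hline, ?_, P₀, hP₀, hγP₀, ?_⟩
  · -- simplicity (c)
    have hm1 : 1 ≤ DirichletDisc.zeroOrder χ ρ := (DirichletDisc.zeroOrder_pos_iff χ h1 ρ).2 hL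
    by_contra hm
    have hm2 : 2 ≤ DirichletDisc.zeroOrder χ ρ := by omega
    have hc4 : (4 : ℝ) ≤ Eρ.card := by
      have := card_index_eq_two_mul hχ hquad h1 hbs hmult (by rw [xiPair_eq_sq hquad, hξ]; simp) hρne
      have h4 : 4 ≤ Eρ.card := by rw [hEρ, this]; omega
      exact_mod_cast h4
    have hb := bound U' Eρ hdisρ
    rw [hsρ'] at hb
    have e1 : 4 * phi (1 / 2) γ δ ≤ Eρ.card * phi (1 / 2) γ δ := mul_le_mul_of_nonneg_right hc4 hφγ0
    linarith only [hb, hU'sum, hC, e1, hcP₀, hφγ, hFh, hw]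
  · -- uniqueness in `P₀` (b)
    intro t htI hLt
    by_contra htne
    have ht0 : 0 < t := by
      rcases ((hZ1 P₀ hP₀).1.trans htI.1).eq_or_lt with h | h
      · exfalso
        apply hhalf
        rw [← h] at hLt
        simpa using hLt
      · exact h
    obtain ⟨ρ', hρ'⟩ : ∃ ρ' : ℂ, ρ' = 1 / 2 + t * I := ⟨_, rfl⟩
    have hre' : ρ'.re = 1 / 2 := by rw [hρ']; simp
    have him' : ρ'.im = t := by rw [hρ']; simp
    have hξ' : dirichletXi χ ρ' = 0 := by
      rw [hρ']
      exact (dirichletXi_eq_zero_iff_mem_charNontrivialZeros hχ h1 _).2 ⟨hLt, by simp, by norm_num⟩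
    have hρ'ne : ρ' ≠ 1 / 2 := by
      intro h
      have h' := congrArg Complex.im h
      rw [him'] at h'
      simp at h'
      exact ht0.ne' h'
    obtain ⟨hs', hc', -⟩ := sum_index_eq hχ hquad h1 hδ hbs hmult hprod hξ'
    set E' := (finite_index hbs ρ').toFinset with hE'
    have himE' : ∀ k ∈ E', |(xiPairZero b k).im| = t := by
      intro k hk
      rcases hmemE ρ' k hk with h | h
      · rw [h, him', abs_of_pos ht0]
      · rw [h, Complex.sub_im, Complex.one_im, him', zero_sub, abs_neg, abs_of_pos ht0]
    have hdis' : Disjoint E' U' := by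
      rw [Finset.disjoint_left]
      intro k hk
      obtain ⟨hb, -⟩ := (Set.Finite.mem_toFinset _).1 hk
      exact hnotU' k hb (by rw [himE' k hk]; exact htI)
    have hdisEE : Disjoint Eρ E' := by
      rw [Finset.disjoint_left]
      intro k hk hk'
      have h := (himE k hk).symm.trans (himE' k hk')
      exact htne h.symm
    have hdis3 : Disjoint (Eρ ∪ E') U' := by
      rw [Finset.disjoint_union_left]; exact ⟨hdisρ, hdis'⟩
    have hb := bound U' (Eρ ∪ E') hdis3
    rw [Finset.sum_union hdisEE, hsρ', hs'] at hb
    rw [hre', him'] at hb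
    have hc'' : (2 : ℝ) ≤ E'.card := by exact_mod_cast hc' hρ'ne
    have hφt0 : 0 ≤ phi (1 / 2) t δ := phi_nonneg (by norm_num) (by norm_num) hδ
    have hct : (1 - 2 * δ) / ((1 / 2 - δ) ^ 2 + P₀.2 ^ 2) ≤ phi (1 / 2) t δ := by
      rw [phi_half]
      exact div_le_div_of_nonneg_left (by linarith) (by positivity) (by nlinarith [htI.1, htI.2, (hZ1 P₀ hP₀).1])
    have e1 : 2 * phi (1 / 2) γ δ ≤ Eρ.card * phi (1 / 2) γ δ := mul_le_mul_of_nonneg_right hcρ' hφγ0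
    have e2 : 2 * phi (1 / 2) t δ ≤ E'.card * phi (1 / 2) t δ := mul_le_mul_of_nonneg_right hc'' hφt0
    linarith only [hb, hU'sum, hC, e1, e2, hct, hφγ, hFh, hw]

end Completeness

end HiaryIrelandKyi2026

namespace HiaryIrelandKyi2026

/-! ### Corollary 1 for both parities (`d < 0` included) -/

section OddParity

open DirichletTheta

variable {q : ℕ} [NeZero q] {χ : DirichletCharacter ℂ q}

/-- For an ODD character (`κ = 1`), `w_{1,−1} = ½ log q − ½ log π + ½ ψ₀(3/2) + (L′/L)(2, χ)` with
`ψ₀(3/2) = 2 − 2 log 2 − λ₀` (Mathlib `Complex.digamma_one_half`, `digamma_apply_add_one`), i.e.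
`w_{1,−1} = ½ log(q/(πe^{λ₀})) + 1 − log 2 + (L′/L)(2, χ)` — the `d < 0` counterpart of the right-hand side of
Corollary 1 (HIK's numerical example §9.2 has `d = −1159523`, `δ = −1`). [cite: HiaryIrelandKyi2026, §4 Corollary 5; §9.2] -/
theorem wOne_neg_one_of_odd (hodd : χ.Odd) :
    wOne χ (-1) = 1 / 2 * Real.log (q / (Real.pi * Real.exp Real.eulerMascheroniConstant)) + 1 - Real.log 2 +
      (deriv χ.LFunction 2 / χ.LFunction 2).re := by
  have hq : (0 : ℝ) < q := by exact_mod_cast NeZero.pos q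
  have h2 : (((1 - (-1 : ℝ)) : ℝ) : ℂ) = 2 := by norm_num
  have hψ : (Complex.digamma (((1 - (-1 : ℝ) + ((charParity χ : ℕ) : ℝ)) / 2 : ℝ) : ℂ)).re =
      2 - 2 * Real.log 2 - Real.eulerMascheroniConstant := by
    rw [charParity_of_odd hodd, Nat.cast_one, show ((1 - (-1 : ℝ) + 1) / 2 : ℝ) = 1 / 2 + 1 by norm_num,
      Complex.ofReal_add, Complex.ofReal_one, show (((1 / 2 : ℝ)) : ℂ) = 1 / 2 by push_cast; ring,
      Complex.digamma_apply_add_one _ (fun m h => by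
        have := congrArg Complex.re h
        simp at this
        have : (0 : ℝ) ≤ m := Nat.cast_nonneg m
        linarith),
      Complex.digamma_one_half]
    have hlog : (Complex.log 2).re = Real.log 2 := by
      rw [show (2 : ℂ) = ((2 : ℝ) : ℂ) by norm_num, Complex.log_ofReal_re]
    simp [hlog]
    ring
  rw [wOne, hψ, h2, Real.log_div hq.ne' (by positivity), Real.log_mul Real.pi_pos.ne' (Real.exp_pos _).ne',
    Real.log_exp]
  ring

variable {b : ℕ → ℂ}

/-- **Corollary 1 for EITHER parity** (in particular for `d < 0`, where HIK state only Theorem 7): odd-multiplicity zeros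
`½ + it`, `t ∈ [γ₋, γ₊] ⊆ [0, τ]`, pairwise disjoint intervals, and `w_{1,−1} < 2ι(η) + Σ 12/(9 + 4γ₊²)` give every zero with
`0 < Re ρ < 1`, `0 < Im ρ ≤ η` on the critical line (for odd `χ` read `w_{1,−1}` through `wOne_neg_one_of_odd`).
[cite: HiaryIrelandKyi2026, §1 Corollary 1; §4 Theorem 7 (i)] -/
theorem corollary1_any_parity (hχ : χ.IsPrimitive) (hquad : χ.IsQuadratic) (h1 : χ ≠ 1) {τ : ℝ}
    {Z : Finset (ℝ × ℝ)} (hZ : IsOddZeroData χ τ Z) {η : ℝ} (hη : 0 < η)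
    (hineq : wOne χ (-1) < 2 * iota η + ∑ P ∈ Z, 12 / (9 + 4 * P.2 ^ 2))
    {ρ : ℂ} (hL : χ.LFunction ρ = 0) (hre0 : 0 < ρ.re) (hre1 : ρ.re < 1) (him0 : 0 < ρ.im) (himη : ρ.im ≤ η) :
    ρ.re = 1 / 2 := by
  rw [← two_mul_iota_eq, ← C_neg_one] at hineq
  obtain ⟨b, hbs, -, hmult, hprod⟩ := exists_xiPair_hadamardSeq hχ h1
  have hδ : (-1 : ℝ) ≤ 0 := by norm_num
  obtain ⟨U, hU, hUsum⟩ := exists_knownZeros_of_zeros hχ hquad h1 hδ hZ.2.1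
    (zeros_of_isOddZeroData hχ hquad h1 hZ) hbs hmult hprod
  exact noOffLine_of_knownZeros hχ hquad h1 hδ hbs hmult hprod hU hUsum hη hineq hL hre0 hre1 him0.ne'
    (by rw [abs_of_pos him0]; exact himη)

end OddParity

end HiaryIrelandKyi2026

end Literature.NumberTheory.LFunctions
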